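/-
Copyright (c) 2026. Released under the Apache 2.0 license.
-/
import Literature.NumberTheory.EllipticCurves.SemistabilityDefectDiscriminantBoundProofs
import Literature.NumberTheory.EllipticCurves.NeronComponentIndexTypeIIIProofs
import Literature.NumberTheory.EllipticCurves.NeronComponentIndexTypeIIIstarProofs
import Mathlib.NumberTheory.NumberField.Basic
import Mathlib.FieldTheory.IsAlgClosed.AlgebraicClosure
import HarnessLib

/-!
# The tame witnesses: on the Kodaira III / III* rows at an odd prime `p`, `E/ℚ` acquires GOOD
# reduction over `ℚ(p^{1/4})` and the semistability defect is EXACTLY `4`; on the `I₀*` row it acquires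
# good reduction over `ℚ(√p)` and the defect is EXACTLY `2` — PROVED
# (Kraus 1990 / Coppola 2020 Thm. 2.7, clauses `I₀*`, III, III* at `p = 3`; Serre 1972 §5.6 at `p ≥ 5`)

`Proofs` file (theorems only: no definition, no named fact, no instance), topic
`Literature/NumberTheory/EllipticCurves`; sequel of `SemistabilityDefectDiscriminantBoundProofs.lean`
(the LOWER bound: `12 / gcd(12, ord_p Δ_min)` divides the defect and the index of every semistability
witness) and, on the TAME rows `I₀*`, III, III*, the DISCHARGE AS THEOREMS of clauses 1, 2 and 3 of
the named fact `Literature.NumberTheory.EllipticCurves.kraus1990_semistabilityDefectAt_three`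
(`SemistabilityDefectAtThree.lean`): "if `E` has type `I₀*`, then … `Gal_L ≅ C₂`; if `E` has type III,
then … `Gal_L ≅ C₄`; if `E` has type III*, then … `Gal_L ≅ C₄`", read — exactly as that file renders
it — as `W.semistabilityDefectAt 3 = 2`, resp. `= 4`
(`WeierstrassCurve.semistabilityDefectAt`, the least ramification index `e(w ∣ p)` of a number field
`F` and a place `w ∋ p` with `W_F` semistable at `w`, `SemistabilityDefect.lean`). The named fact
itself (six clauses) stays a `def … : Prop`; its users on the III / III* rows can now take the
theorems below instead of the hypothesis `h`.

Written by the literature typer of route `Summits/BirchSwinnertonDyer/…/Theses/TameQuarticManinParity.lean`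
(census rows `(t′)` at `3` = Kodaira III / III*, Summits-side dictionary
`subTprime_three_iff_kodairaSymbolAt_III_or_IIIstar`), whose thesis rests on "`n = 4 = e`, so the
curve's semistabilising ring IS the modular curve's (`T = U`)": with this file BOTH halves of
"`e = 4`" are tree theorems — every semistabilising place has `4 ∣ e(w ∣ 3)`
(`SemistabilityDefectDiscriminantBoundProofs`), and `ℚ(3^{1/4})` semistabilises (here).

## The printed argument followed

[FreitasKraus2022] N. Freitas, A. Kraus, *On the symplectic type of isomorphisms of the p-torsion of
elliptic curves*, Mem. AMS 277 (2022) no. 1363, §4 (held text `paper:arxiv-1607.01218`, chunk p0032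
L11–17): "Let `ℓ ≥ 3` … `e = 4` … `F = ℚ_ℓ(π)`, `π⁴ = ℓ` … `L = ℚ_ℓ^{un}K = ℚ_ℓ^{un}F` is the minimal
extension of `ℚ_ℓ^{un}` where `E` gets good reduction; it is also the unique degree `4` tame extension
of `ℚ_ℓ^{un}`", and proof of Lemma 13 (p0032 L54): "From [Kraus1990] we know that `E` has Kodaira
type III or III* (because `e = 4`)"; the good model is Tate's normal form rescaled by `π`
(Silverman *ATAEC* IV.9.4 Step 4: type III has `π ∣ a₁, a₂, a₃, a₄`, `π² ∣ a₆`, `v(Δ) = 3`; Step 9: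
type III* has `π ∣ a₁`, `π² ∣ a₂`, `π³ ∣ a₃, a₄`, `π⁵ ∣ a₆`, `v(Δ) = 9` — Table 4.1), exactly as the
Summits-side LOCAL construction `Additive/GoodModelTameThree.lean` does over `ℚ̄₃ ⊇ ℚ₃(3^{1/4})`.
What is new here is the GLOBAL (number-field) witness that `semistabilityDefectAt` quantifies over,
which needs a `ℚ`-RATIONAL Tate normal form (§3: approximation of the local change of variables,
Silverman *AEC* VIII.8 proof of Prop. 8.2) and the valuation bookkeeping `|x|_w = |x|_v^{e(w∣v)}`
(Mathlib `IsDedekindDomain.HeightOneSpectrum.valuation_liesOver`).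

## What is PROVED (all unconditional, standard axioms)

§1 `VariableChange.exists_valued_mul_inv_le` — over the fraction field `K` of any Dedekind domain:
every change of variables `C_v` over `K_v` is `K`-rationally approximable, `C_{K_v} · C_v⁻¹ = (u, r, s, t)`
with `|u| = 1` and `|r|, |s|, |t| ≤ ε` for any `ε > 0`.
§2 `valuation_variableChange_le_max` — such a small change preserves `|aᵢ| ≤ max(|aᵢ|, ε)` and `|Δ|`
(any valued field).
§3 `valuation_j_le_one_of_hasGoodReductionAt_dedekind`, `…_baseChange_dedekind` (good reduction, also
upstairs, forces `|j|_v ≤ 1`); `exists_variableChange_valuation_le_of_localModel` — a `K`-rational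
equation with any divisibility profile realised by the local minimal model, and `|Δ|_v = |ϖ|^{ord_v Δ_min}`.
§4 `exists_variableChange_tateNormalForm_III` / `_IIIstar` — the rational Tate normal forms at a place
`v ∤ 2` with perfect residue field (profiles `(1,1,1,1,2)`, `v(Δ) = 3`, resp. `(1,2,3,3,5)`, `v(Δ) = 9`).
§5 `hasGoodReductionAt_baseChange_of_pow_four_eq_of_profile` (the rescaling by `θ^j`, `θ⁴ = p`) and
**`hasGoodReductionAt_baseChange_of_pow_four_eq_of_kodairaSymbolAt_eq_III_or_IIIstar`**: `W/ℚ`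
elliptic of type III / III* at the place over an odd prime `p`, `F` ANY number field with `θ ∈ F`,
`θ⁴ = p`, `w ∋ p` ANY place of `F` ⟹ `W_F` has good reduction at `w`.
§6 `exists_numberField_pow_four_eq_natCast` (`F = ℚ[X]/(minpoly of p^{1/4})`, `[F:ℚ] ≤ 4`);
**`isSemistabilityWitnessAt_four_of_kodairaSymbolAt_eq_III_or_IIIstar`** (a witness of index EXACTLY
`4`: `4 ∣ e(w ∣ p) ≤ [F : ℚ] ≤ 4`); `semistabilityDefectAt_le_four_…`;
`padicValRat_j_nonneg_of_kodairaSymbolAt_eq_III_or_IIIstar` (these rows are potentially good — no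
hypothesis on `j` is needed anywhere); **`semistabilityDefectAt_eq_four_of_kodairaSymbolAt_eq_III_or_IIIstar`**
(`W.semistabilityDefectAt p = 4` at every odd `p`); `four_dvd_of_isSemistabilityWitnessAt_of_…`.
§7 at `p = 3`: `kraus_semistabilityDefectAt_three_eq_four_of_III`, `…_of_IIIstar`,
`isSemistabilityWitnessAt_three_four_of_kodairaSymbolAt_eq_III_or_IIIstar`,
`not_dvd_two_and_dvd_four_semistabilityDefectAt_three_of_kodairaSymbolAt_eq_III_or_IIIstar` — the
hypothesis-free forms of the `h`-conditional corollaries of `SemistabilityDefectAtThree.lean`.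
§8 the QUADRATIC witness on the `I₀*` row (the census cell (G) at `3`, `e ∣ q − 1`):
`hasGoodReductionAt_baseChange_of_pow_eq_of_profile` (rescaling by `θ^j`, `θⁿ = p`, any `n ≥ 1`),
`exists_variableChange_tateNormalForm_Istar_zero` (profile `(1,1,2,2,3)`, `v(Δ) = 6`),
`hasGoodReductionAt_baseChange_of_sq_eq_of_kodairaSymbolAt_eq_Istar_zero` (any number field ∋ `√p`),
`isSemistabilityWitnessAt_two_of_kodairaSymbolAt_eq_Istar_zero`,
**`semistabilityDefectAt_eq_two_of_kodairaSymbolAt_eq_Istar_zero`** (defect `= 2` at every odd `p`),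
`kraus_semistabilityDefectAt_three_eq_two_of_Istar_zero`, `semistabilityDefectAt_three_dvd_two_…`.

## What is NOT here

The three WILD clauses of Kraus's theorem at `3` (`↦ 3, 6, 12`: they need wild ramification theory,
not valuations of a tame Kummer generator); `p = 2` (types III / `I₀*` there have other `v(Δ)`); the
group structure of `Gal_L`; any Manin-constant statement (the route's cruxes 24498 / 24627 are
untouched: this file settles only the local input "`e = 4`" of the thesis).

## References

* [FreitasKraus2022] N. Freitas, A. Kraus, Mem. Amer. Math. Soc. 277 (2022), no. 1363, §3.3, §4.
* [Coppola2020] N. Coppola, Acta Arith. 195 (2020) 289–303, §2 Thm. 2.7 (= [Kraus1990] at `p = 3`).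
* [Kraus1990] A. Kraus, Manuscripta Math. 69 (1990) 353–385 (not held; cited through the two above).
* [SilvermanATAEC1994] J. H. Silverman, GTM 151, IV.9.4 Steps 4 and 9, Table 4.1.
* [SilvermanAEC2009] J. H. Silverman, GTM 106 (2nd ed.), III Table 3.1, VII.1 Prop. 1.3 / Remark 1.1,
  VII.5 Prop. 5.1, 5.4, 5.5, VIII.8 proof of Prop. 8.2.
* [Serre1972] J.-P. Serre, Invent. Math. 15 (1972) §5.6 (`|Φ_p| = 12/gcd(12, v(Δ))`, `p ≥ 5`).
-/

noncomputable section

open scoped Classical NumberField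

open IsDedekindDomain IsDedekindDomain.HeightOneSpectrum WithZero

/-! ## §1. Rational approximation of a local change of variables -/

namespace IsDedekindDomain.HeightOneSpectrum

variable {R : Type*} [CommRing R] [IsDedekindDomain R] (K : Type*) [Field K] [Algebra R K]
  [IsFractionRing R K]

/-- Density of `K` in `K_v`, metric form: every `y ∈ K_v` has elements of `K` within any nonzero
radius `δ` (Mathlib `denseRange_algebraMap`; the same plumbing as in
`SemistableReductionBaseChange.lean` §1, where it is private). [folklore] -/
private theorem exists_valued_algebraMap_sub_lt' (v : HeightOneSpectrum R) (y : v.adicCompletion K)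
    {δ : ℤᵐ⁰} (hδ : δ ≠ 0) :
    ∃ r : K, Valued.v (algebraMap K (v.adicCompletion K) r - y) < δ := by
  obtain ⟨c, hc⟩ := valuedAdicCompletion_surjective K v δ
  have hc0 : Valued.v c ≠ 0 := hc ▸ hδ
  have hS : {z : v.adicCompletion K | Valued.v (z - y) < Valued.v c} ∈ nhds y := by
    rw [Valued.mem_nhds]
    refine ⟨Units.mk0 (Valued.v.restrict c) (by simpa using hc0), fun z hz => ?_⟩
    simp only [Set.mem_setOf_eq, Units.val_mk0] at hz ⊢
    exact (Valuation.restrict_lt_iff _).mp hz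
  obtain ⟨x, hx⟩ := (denseRange_algebraMap K v).mem_nhds hS
  refine ⟨x, ?_⟩
  simpa only [Set.mem_setOf_eq, hc] using hx

end IsDedekindDomain.HeightOneSpectrum

namespace WeierstrassCurve

section Approximation

variable {R : Type*} [CommRing R] [IsDedekindDomain R] {K : Type*} [Field K] [Algebra R K]
  [IsFractionRing R K]

/-- **Rational approximation of a local change of variables** (the approximation step of
Silverman, *AEC* VIII.8, proof of Prop. 8.2, p. 212, sharpened): for every change of variables
`C_v = (u_v, r_v, s_v, t_v)` over the completion `K_v` and every radius `0 < ε`, there is a change of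
variables `C = (u, r, s, t)` over `K` such that the comparison `D = C_{K_v} · C_v⁻¹` has `v`-UNIT `u`
and `|r|, |s|, |t| ≤ ε`: take `u ∈ K` with `|u|_v = |u_v|_v` and `r, s, t ∈ K` `v`-adically close to
`r_v, s_v, t_v` (density of `K` in `K_v`). [cite: SilvermanAEC2009, VIII.8 proof of Prop. 8.2 (p. 212)] -/
theorem VariableChange.exists_valued_mul_inv_le (v : HeightOneSpectrum R)
    (Cv : VariableChange (v.adicCompletion K)) {ε : ℤᵐ⁰} (hε : ε ≠ 0) :
    ∃ C : VariableChange K,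
      Valued.v ((C.baseChange (v.adicCompletion K) * Cv⁻¹).u : v.adicCompletion K) = 1 ∧
      Valued.v (C.baseChange (v.adicCompletion K) * Cv⁻¹).r ≤ ε ∧
      Valued.v (C.baseChange (v.adicCompletion K) * Cv⁻¹).s ≤ ε ∧
      Valued.v (C.baseChange (v.adicCompletion K) * Cv⁻¹).t ≤ ε := by
  obtain ⟨ι, hι⟩ : ∃ ι : K →+* v.adicCompletion K, ι = algebraMap K _ := ⟨_, rfl⟩
  have hιv : ∀ x : K, Valued.v (ι x) = v.valuation K x := fun x => by
    rw [hι]; exact valuedAdicCompletion_eq_valuation' v x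
  have ha0 : Valued.v Cv.u.val ≠ 0 := (Valuation.ne_zero_iff _).mpr Cv.u.ne_zero
  set a : ℤᵐ⁰ := Valued.v Cv.u.val with ha
  -- the global `u`
  obtain ⟨u, huv⟩ := v.valuation_surjective K a
  have hu0 : u ≠ 0 := by
    rintro rfl
    exact ha0 (by rw [← huv, map_zero])
  have hιu : Valued.v (ι u) = a := by rw [hιv, huv]
  -- radii, and the global `r, s, t`
  set b : ℤᵐ⁰ := max (Valued.v Cv.s) 1 with hb
  have hb0 : b ≠ 0 := ne_of_gt (lt_of_lt_of_le one_pos (le_max_right _ _))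
  have hδr : min (ε * a ^ 2) (ε * a ^ 3 / b) ≠ 0 := by
    rcases min_choice (ε * a ^ 2) (ε * a ^ 3 / b) with h | h <;> rw [h]
    · exact mul_ne_zero hε (pow_ne_zero _ ha0)
    · exact div_ne_zero (mul_ne_zero hε (pow_ne_zero _ ha0)) hb0
  obtain ⟨r, hr⟩ := v.exists_valued_algebraMap_sub_lt' K Cv.r hδr
  obtain ⟨s, hs⟩ := v.exists_valued_algebraMap_sub_lt' K Cv.s (mul_ne_zero hε ha0)
  obtain ⟨t, ht⟩ := v.exists_valued_algebraMap_sub_lt' K Cv.t (mul_ne_zero hε (pow_ne_zero 3 ha0))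
  rw [← hι] at hr hs ht
  have hr2 : Valued.v (ι r - Cv.r) ≤ ε * a ^ 2 := (lt_of_lt_of_le hr (min_le_left _ _)).le
  have hr3 : Valued.v Cv.s * Valued.v (ι r - Cv.r) ≤ ε * a ^ 3 :=
    calc Valued.v Cv.s * Valued.v (ι r - Cv.r) ≤ b * (ε * a ^ 3 / b) :=
          mul_le_mul' (le_max_left _ _) (lt_of_lt_of_le hr (min_le_right _ _)).le
      _ = ε * a ^ 3 := mul_div_cancel₀ _ hb0
  -- the global change of variables `C`; `D` compares it with the local one
  let C : VariableChange K := ⟨Units.mk0 u hu0, r, s, t⟩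
  refine ⟨C, ?_, ?_, ?_, ?_⟩
  · have hDu : ((C.baseChange (v.adicCompletion K) * Cv⁻¹).u : v.adicCompletion K) =
        ι u * Cv.u.val⁻¹ := by
      simp [C, VariableChange.mul_def, VariableChange.inv_def, VariableChange.baseChange,
        VariableChange.map, hι]
    rw [hDu, map_mul, map_inv₀, hιu, ha, mul_inv_cancel₀ ha0]
  · have hDr : (C.baseChange (v.adicCompletion K) * Cv⁻¹).r = (ι r - Cv.r) * Cv.u.val⁻¹ ^ 2 := by
      simp only [C, VariableChange.mul_def, VariableChange.inv_def, VariableChange.baseChange,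
        VariableChange.map, hι, Units.val_inv_eq_inv_val]
      ring
    rw [hDr, map_mul, map_pow, map_inv₀, ← ha]
    calc Valued.v (ι r - Cv.r) * a⁻¹ ^ 2 ≤ ε * a ^ 2 * a⁻¹ ^ 2 := mul_le_mul_left hr2 _
      _ = ε := by rw [inv_pow, mul_assoc, mul_inv_cancel₀ (pow_ne_zero _ ha0), mul_one]
  · have hDs : (C.baseChange (v.adicCompletion K) * Cv⁻¹).s = (ι s - Cv.s) * Cv.u.val⁻¹ := by
      simp only [C, VariableChange.mul_def, VariableChange.inv_def, VariableChange.baseChange,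
        VariableChange.map, hι, Units.val_inv_eq_inv_val]
      ring
    rw [hDs, map_mul, map_inv₀, ← ha]
    calc Valued.v (ι s - Cv.s) * a⁻¹ ≤ ε * a * a⁻¹ := mul_le_mul_left hs.le _
      _ = ε := by rw [mul_assoc, mul_inv_cancel₀ ha0, mul_one]
  · have hDt : (C.baseChange (v.adicCompletion K) * Cv⁻¹).t =
        ((ι t - Cv.t) - Cv.s * (ι r - Cv.r)) * Cv.u.val⁻¹ ^ 3 := by
      simp only [C, VariableChange.mul_def, VariableChange.inv_def, VariableChange.baseChange,
        VariableChange.map, hι, Units.val_inv_eq_inv_val]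
      ring
    rw [hDt, map_mul, map_pow, map_inv₀, ← ha]
    calc Valued.v ((ι t - Cv.t) - Cv.s * (ι r - Cv.r)) * a⁻¹ ^ 3 ≤ ε * a ^ 3 * a⁻¹ ^ 3 := by
          refine mul_le_mul_left ((Valuation.map_sub _ _ _).trans (max_le ht.le ?_)) _
          rwa [map_mul]
      _ = ε := by rw [inv_pow, mul_assoc, mul_inv_cancel₀ (pow_ne_zero _ ha0), mul_one]

end Approximation

/-! ## §2. A small change of variables preserves the divisibility profile of the coefficients -/

section Perturbation

variable {L : Type*} [Field L] {Γ₀ : Type*} [LinearOrderedCommGroupWithZero Γ₀]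
  (val : Valuation L Γ₀) (J : WeierstrassCurve L) (D : VariableChange L)

/-- **Perturbation lemma.** For an equation `J` with `val`-integral coefficients and a change of
variables `D = (u, r, s, t)` with `|u| = 1` and `|r|, |s|, |t| ≤ ε ≤ 1`, each coefficient of `D • J`
has `|aᵢ(D • J)| ≤ max(|aᵢ(J)|, ε)` (read off Silverman, *AEC* III Table 3.1: every term of
`uⁱ aᵢ' − aᵢ` contains a factor `r`, `s` or `t`), and `|Δ(D • J)| = |Δ(J)|`. Elementary ultrametric
bookkeeping. [cite: SilvermanAEC2009, III §1 Table 3.1 (change-of-variables formulae)] -/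
theorem valuation_variableChange_le_max (hu : val (D.u : L) = 1) {ε : Γ₀} (hε : ε ≤ 1)
    (hr : val D.r ≤ ε) (hs : val D.s ≤ ε) (ht : val D.t ≤ ε)
    (h₁ : val J.a₁ ≤ 1) (h₂ : val J.a₂ ≤ 1) (h₃ : val J.a₃ ≤ 1) (h₄ : val J.a₄ ≤ 1) :
    val (D • J).a₁ ≤ max (val J.a₁) ε ∧ val (D • J).a₂ ≤ max (val J.a₂) ε ∧
      val (D • J).a₃ ≤ max (val J.a₃) ε ∧ val (D • J).a₄ ≤ max (val J.a₄) ε ∧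
      val (D • J).a₆ ≤ max (val J.a₆) ε ∧ val (D • J).Δ = val J.Δ := by
  have hui : val (↑D.u⁻¹ : L) = 1 := by
    rw [Units.val_inv_eq_inv_val, map_inv₀, hu, inv_one]
  have hnat : ∀ n : ℕ, val (n : L) ≤ 1 := fun n => by
    induction n with
    | zero => simp
    | succ n ih =>
      push_cast
      exact val.map_add_le ih (le_of_eq val.map_one)
  have h2 : val (2 : L) ≤ 1 := by simpa using hnat 2
  have h3 : val (3 : L) ≤ 1 := by simpa using hnat 3
  -- small × integral is small
  have hmul : ∀ x y : L, val x ≤ ε → val y ≤ 1 → val (x * y) ≤ ε := fun x y hx hy => by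
    rw [map_mul]
    calc val x * val y ≤ ε * 1 := mul_le_mul' hx hy
      _ = ε := mul_one ε
  have hmul' : ∀ x y : L, val x ≤ 1 → val y ≤ ε → val (x * y) ≤ ε := fun x y hx hy => by
    rw [mul_comm]; exact hmul y x hy hx
  have hpow : ∀ (x : L) (n : ℕ), val x ≤ ε → n ≠ 0 → val (x ^ n) ≤ ε := fun x n hx hn => by
    obtain ⟨m, rfl⟩ := Nat.exists_eq_succ_of_ne_zero hn
    rw [pow_succ, mul_comm]
    exact hmul x _ hx (by rw [map_pow]; exact pow_le_one₀ zero_le (hx.trans hε))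
  have hrs : val D.r ≤ 1 := hr.trans hε
  have hss : val D.s ≤ 1 := hs.trans hε
  have hts : val D.t ≤ 1 := ht.trans hε
  refine ⟨?_, ?_, ?_, ?_, ?_, ?_⟩
  · -- `a₁' = u⁻¹ (a₁ + 2 s)`
    rw [variableChange_a₁, map_mul, hui, one_mul]
    exact val.map_add_le (le_max_left _ _) ((hmul' 2 D.s h2 hs).trans (le_max_right _ _))
  · -- `a₂' = u⁻² (a₂ − s a₁ + 3 r − s²)`
    rw [variableChange_a₂, map_mul, map_pow, hui, one_pow, one_mul]
    refine val.map_sub_le (val.map_add_le (val.map_sub_le (le_max_left _ _) ?_) ?_) ?_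
    · exact (hmul D.s J.a₁ hs h₁).trans (le_max_right _ _)
    · exact (hmul' 3 D.r h3 hr).trans (le_max_right _ _)
    · exact (hpow D.s 2 hs two_ne_zero).trans (le_max_right _ _)
  · -- `a₃' = u⁻³ (a₃ + r a₁ + 2 t)`
    rw [variableChange_a₃, map_mul, map_pow, hui, one_pow, one_mul]
    refine val.map_add_le (val.map_add_le (le_max_left _ _) ?_) ?_
    · exact (hmul D.r J.a₁ hr h₁).trans (le_max_right _ _)
    · exact (hmul' 2 D.t h2 ht).trans (le_max_right _ _)
  · -- `a₄' = u⁻⁴ (a₄ − s a₃ + 2 r a₂ − (t + r s) a₁ + 3 r² − 2 s t)`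
    rw [variableChange_a₄, map_mul, map_pow, hui, one_pow, one_mul]
    refine val.map_sub_le (val.map_add_le (val.map_sub_le (val.map_add_le (val.map_sub_le
      (le_max_left _ _) ?_) ?_) ?_) ?_) ?_
    · exact (hmul D.s J.a₃ hs h₃).trans (le_max_right _ _)
    · exact (hmul (2 * D.r) J.a₂ (hmul' 2 D.r h2 hr) h₂).trans (le_max_right _ _)
    · exact (hmul (D.t + D.r * D.s) J.a₁ (val.map_add_le ht (hmul D.r D.s hr hss)) h₁).trans
        (le_max_right _ _)
    · exact (hmul' 3 (D.r ^ 2) h3 (hpow D.r 2 hr two_ne_zero)).trans (le_max_right _ _)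
    · exact (hmul (2 * D.s) D.t (hmul' 2 D.s h2 hs) hts).trans (le_max_right _ _)
  · -- `a₆' = u⁻⁶ (a₆ + r a₄ + r² a₂ + r³ − t a₃ − t² − r t a₁)`
    rw [variableChange_a₆, map_mul, map_pow, hui, one_pow, one_mul]
    refine val.map_sub_le (val.map_sub_le (val.map_sub_le (val.map_add_le (val.map_add_le
      (val.map_add_le (le_max_left _ _) ?_) ?_) ?_) ?_) ?_) ?_
    · exact (hmul D.r J.a₄ hr h₄).trans (le_max_right _ _)
    · exact (hmul (D.r ^ 2) J.a₂ (hpow D.r 2 hr two_ne_zero) h₂).trans (le_max_right _ _)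
    · exact (hpow D.r 3 hr three_ne_zero).trans (le_max_right _ _)
    · exact (hmul D.t J.a₃ ht h₃).trans (le_max_right _ _)
    · exact (hpow D.t 2 ht two_ne_zero).trans (le_max_right _ _)
    · exact (hmul (D.r * D.t) J.a₁ (hmul D.r D.t hr hts) h₁).trans (le_max_right _ _)
  · -- `Δ' = u⁻¹² Δ`
    rw [variableChange_Δ, map_mul, map_pow, hui, one_pow, one_mul]

end Perturbation

/-! ## §3. A `K`-rational equation with the Tate normal-form profile at `v` -/

section Valuation

variable {A : Type*} [CommRing A] [IsDedekindDomain A] {K : Type*} [Field K] [Algebra A K]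
  [IsFractionRing A K] (v : HeightOneSpectrum A) (W : WeierstrassCurve K)

/-- **`|j(W)|_v ≤ 1` at a place of good reduction** (Silverman, *AEC*, Prop. VII.5.1 (a): the local
minimal model has unit discriminant and integral `c₄`, and `j · Δ = c₄³`). The number-field / `GenEll`
copies of the tree (`valuation_j_le_one_of_hasGoodReductionAt`, Castella 2018 file;
`valuation_j_le_one_of_hasGoodReduction_localMinimalModel`, `GenEllMellReduction.lean`) live in import
cones foreign to this file; this is the same computation over any Dedekind domain.
[cite: SilvermanAEC2009, VII.5 Prop. 5.1 (a) and Prop. 5.5] -/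
theorem valuation_j_le_one_of_hasGoodReductionAt_dedekind [W.IsElliptic]
    (hv : W.HasGoodReductionAt v) : v.valuation K W.j ≤ 1 := by
  haveI := W.isElliptic_localMinimalModel v
  set Kv := v.adicCompletion K
  set E := W.localMinimalModel v with hE
  have hg : E.HasGoodReduction (v.adicCompletionIntegers K) := hv
  haveI : E.IsMinimal (v.adicCompletionIntegers K) := hg.toIsMinimal
  have hjE : E.j = algebraMap K Kv W.j := by
    have hC : (((W.baseChange Kv).exists_isMinimal (v.adicCompletionIntegers K)).choose •
        W.baseChange Kv).j = algebraMap K Kv W.j := by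
      rw [WeierstrassCurve.variableChange_j]; exact W.map_j _
    exact hC
  have hequiv := WeierstrassCurve.isEquiv_valuation_maximalIdeal_of_le_one_iff
    (WeierstrassCurve.valued_le_one_iff_mem_range_adicCompletionIntegers v (K := K))
  set w := (IsDiscreteValuationRing.maximalIdeal (v.adicCompletionIntegers K)).valuation Kv
    with hw
  have key : E.j * E.Δ = E.c₄ ^ 3 := by
    rw [WeierstrassCurve.j, ← WeierstrassCurve.coe_Δ', mul_comm, ← mul_assoc, Units.mul_inv,
      one_mul]
  have hval := congrArg w key
  rw [map_mul, map_pow, hg.goodReduction, mul_one] at hval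
  have hc4 : w E.c₄ ≤ 1 := by
    rw [← WeierstrassCurve.integralModel_c₄_eq (v.adicCompletionIntegers K) E]
    exact HeightOneSpectrum.valuation_le_one _ _
  have hwj : w E.j ≤ 1 := by
    rw [hval]; exact pow_le_one₀ zero_le hc4
  have h2 : Valued.v (algebraMap K Kv W.j) ≤ 1 := by
    rw [← hjE]; exact hequiv.le_one_iff_le_one.mp hwj
  rwa [WeierstrassCurve.valued_algebraMap_adicCompletion] at h2

end Valuation

section BaseChangeJ

variable {A K : Type*} (L : Type*) {B : Type*} [CommRing A] [IsDedekindDomain A] [CommRing B]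
  [IsDedekindDomain B] [Algebra A B] [Module.IsTorsionFree A B] [Field K] [Field L] [Algebra K L]
  [Algebra A K] [IsFractionRing A K] [Algebra A L] [IsScalarTower A K L] [Algebra B L]
  [IsFractionRing B L] [IsScalarTower A B L] {v : HeightOneSpectrum A} {w : HeightOneSpectrum B}
  [w.asIdeal.LiesOver v.asIdeal] (W : WeierstrassCurve K)

/-- **Good reduction upstairs forces `|j|_v ≤ 1` downstairs** (Silverman VII.5.5, direction "potential
good reduction ⇒ `j` integral": `|j|_w ≤ 1` and `|j|_w = |j|_v^{e(w∣v)}` with `e(w∣v) ≥ 1`).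
[cite: SilvermanAEC2009, VII.5 Prop. 5.5 (proof, PDF p. 177: "j(E) = (c′₄)³/Δ′ ∈ R′ … so j(E) ∈ R")] -/
theorem valuation_j_le_one_of_hasGoodReductionAt_baseChange_dedekind [W.IsElliptic]
    (hgood : (W.baseChange L).HasGoodReductionAt w) : v.valuation K W.j ≤ 1 := by
  haveI : (W.baseChange L).IsElliptic := inferInstanceAs ((W.map (algebraMap K L)).IsElliptic)
  have h := (W.baseChange L).valuation_j_le_one_of_hasGoodReductionAt_dedekind w hgood
  have hjL : (W.baseChange L).j = algebraMap K L W.j := W.map_j (algebraMap K L)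
  rw [hjL, ← IsDedekindDomain.HeightOneSpectrum.valuation_liesOver L v w W.j] at h
  have he : v.asIdeal.ramificationIdx' w.asIdeal ≠ 0 :=
    Ideal.IsDedekindDomain.ramificationIdx'_ne_zero_of_liesOver w.asIdeal v.ne_bot
  by_contra hlt
  push Not at hlt
  exact absurd h (not_le.mpr (one_lt_pow₀ hlt he))

end BaseChangeJ

section RationalNormalForm

open Literature.NumberTheory.DiophantineGeometry Literature.NumberTheory.EllipticCurves

variable {A : Type*} [CommRing A] [IsDedekindDomain A] {K : Type*} [Field K] [Algebra A K]
  [IsFractionRing A K] (v : HeightOneSpectrum A) (W : WeierstrassCurve K)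

/-- **A `K`-rational equation with a prescribed divisibility profile at `v`.** Let `V` be the integral
minimal model of `W` at `v` (over `O_v`) and `D` a change of variables over `O_v` such that the
coefficients of `D • V` lie in `𝔪_v^{k₁}, 𝔪_v^{k₂}, 𝔪_v^{k₃}, 𝔪_v^{k₄}, 𝔪_v^{k₆}` (a TATE NORMAL FORM,
Silverman *ATAEC* IV.9.4). Then some `K`-rational equation `C • W` has
`|a₁|_v ≤ |ϖ|^{k₁}, …, |a₆|_v ≤ |ϖ|^{k₆}` and `|Δ|_v = |ϖ|^{ord_v Δ_min}`: approximate the local change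
of variables by a `K`-rational one (`VariableChange.exists_valued_mul_inv_le`); the error is a change of
variables with unit `u` and `r, s, t` of valuation `≤ |ϖ|^{k₁+⋯+k₆}`, which preserves the profile
(`valuation_variableChange_le_max`). Here `ϖ ∈ O_v` is any uniformiser, entered through an element
`π ∈ K` with `|π|_v = exp(−1)`. [cite: SilvermanAEC2009, VIII.8 proof of Prop. 8.2 (p. 212) and VII.1 Prop. 1.3] [cite: SilvermanATAEC1994, IV.9.4 (Tate's algorithm; normal forms of Steps 4 and 9)] -/
theorem exists_variableChange_valuation_le_of_localModel [W.IsElliptic]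
    (D : VariableChange (v.adicCompletionIntegers K)) {k₁ k₂ k₃ k₄ k₆ : ℕ}
    (h₁ : (D • W.localMinimalIntegralModel v).a₁ ∈
      IsLocalRing.maximalIdeal (v.adicCompletionIntegers K) ^ k₁)
    (h₂ : (D • W.localMinimalIntegralModel v).a₂ ∈
      IsLocalRing.maximalIdeal (v.adicCompletionIntegers K) ^ k₂)
    (h₃ : (D • W.localMinimalIntegralModel v).a₃ ∈
      IsLocalRing.maximalIdeal (v.adicCompletionIntegers K) ^ k₃)
    (h₄ : (D • W.localMinimalIntegralModel v).a₄ ∈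
      IsLocalRing.maximalIdeal (v.adicCompletionIntegers K) ^ k₄)
    (h₆ : (D • W.localMinimalIntegralModel v).a₆ ∈
      IsLocalRing.maximalIdeal (v.adicCompletionIntegers K) ^ k₆) :
    ∃ C : VariableChange K,
      v.valuation K (C • W).a₁ ≤ exp (-(k₁ : ℤ)) ∧ v.valuation K (C • W).a₂ ≤ exp (-(k₂ : ℤ)) ∧
      v.valuation K (C • W).a₃ ≤ exp (-(k₃ : ℤ)) ∧ v.valuation K (C • W).a₄ ≤ exp (-(k₄ : ℤ)) ∧
      v.valuation K (C • W).a₆ ≤ exp (-(k₆ : ℤ)) ∧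
      v.valuation K (C • W).Δ = exp (-(W.ordMinimalDiscriminant v : ℤ)) := by
  haveI := W.isElliptic_localMinimalModel v
  -- powers of the maximal ideal, read in valuations
  have hint : ∀ y : v.adicCompletionIntegers K, Valued.v (y : v.adicCompletion K) ≤ 1 := fun y => y.2
  obtain ⟨ϖ, hϖ⟩ := IsDiscreteValuationRing.exists_irreducible (v.adicCompletionIntegers K)
  have hϖ1 : Valued.v (ϖ : v.adicCompletion K) < 1 :=
    lt_of_le_of_ne (hint ϖ) fun h =>
      hϖ.not_isUnit (adicCompletionIntegers.isUnit_iff_valued_eq_one.mpr h)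
  have hϖle : Valued.v (ϖ : v.adicCompletion K) ≤ exp (-1 : ℤ) := by
    have h0 : Valued.v (ϖ : v.adicCompletion K) ≠ 0 :=
      (Valuation.ne_zero_iff _).mpr (by exact_mod_cast hϖ.ne_zero)
    rw [← exp_log h0, exp_le_exp]
    rw [← exp_log h0, ← exp_zero, exp_lt_exp] at hϖ1
    omega
  have hpow : ∀ (x : v.adicCompletionIntegers K) (k : ℕ),
      x ∈ IsLocalRing.maximalIdeal (v.adicCompletionIntegers K) ^ k →
      Valued.v (x : v.adicCompletion K) ≤ exp (-(k : ℤ)) := fun x k hx => by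
    obtain ⟨y, rfl⟩ := (TateAlgorithm.mem_maximalIdeal_pow_iff_dvd_of_irreducible hϖ x k).mp hx
    push_cast
    rw [map_mul, map_pow]
    calc Valued.v (ϖ : v.adicCompletion K) ^ k * Valued.v (y : v.adicCompletion K)
        ≤ exp (-1 : ℤ) ^ k * 1 := mul_le_mul' (pow_le_pow_left₀ zero_le hϖle k) (hint y)
      _ = exp (-(k : ℤ)) := by rw [mul_one, ← exp_nsmul]; simp
  -- the local change of variables to `J = D • V` and its rational approximation
  have hmin : ((W.baseChange (v.adicCompletion K)).exists_isMinimal (v.adicCompletionIntegers K)).choose • W.baseChange (v.adicCompletion K) =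
      (W.localMinimalIntegralModel v).map (algebraMap (v.adicCompletionIntegers K) (v.adicCompletion K)) :=
    (baseChange_integralModel_eq (v.adicCompletionIntegers K) (W.localMinimalModel v)).symm
  have hJ : (D.map (algebraMap (v.adicCompletionIntegers K) (v.adicCompletion K)) * ((W.baseChange (v.adicCompletion K)).exists_isMinimal (v.adicCompletionIntegers K)).choose) •
      W.baseChange (v.adicCompletion K) = (D • (W.localMinimalIntegralModel v)).map (algebraMap (v.adicCompletionIntegers K) (v.adicCompletion K)) := by
    rw [mul_smul, hmin, map_variableChange]
  have hε0 : (exp (-((k₁ + k₂ + k₃ + k₄ + k₆ : ℕ) : ℤ)) : ℤᵐ⁰) ≠ 0 := exp_ne_zero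
  have hε1 : (exp (-((k₁ + k₂ + k₃ + k₄ + k₆ : ℕ) : ℤ)) : ℤᵐ⁰) ≤ 1 := by
    rw [← exp_zero, exp_le_exp]; omega
  have hεk : ∀ k : ℕ, k ≤ k₁ + k₂ + k₃ + k₄ + k₆ →
      (exp (-((k₁ + k₂ + k₃ + k₄ + k₆ : ℕ) : ℤ)) : ℤᵐ⁰) ≤ exp (-(k : ℤ)) := fun k hk => by
    rw [exp_le_exp]; omega
  obtain ⟨C, hu, hr, hs, ht⟩ := VariableChange.exists_valued_mul_inv_le v
    (D.map (algebraMap (v.adicCompletionIntegers K) (v.adicCompletion K)) * ((W.baseChange (v.adicCompletion K)).exists_isMinimal (v.adicCompletionIntegers K)).choose) hε0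
  have hCW : (C • W).baseChange (v.adicCompletion K) =
      (C.baseChange (v.adicCompletion K) * (D.map (algebraMap (v.adicCompletionIntegers K) (v.adicCompletion K)) *
        ((W.baseChange (v.adicCompletion K)).exists_isMinimal (v.adicCompletionIntegers K)).choose)⁻¹) •
        (D • (W.localMinimalIntegralModel v)).map (algebraMap (v.adicCompletionIntegers K) (v.adicCompletion K)) := by
    rw [baseChange_smul_eq, ← hJ, ← mul_smul, inv_mul_cancel_right]
  -- the profile of `J` in valuations
  have hJ₁ : Valued.v ((D • (W.localMinimalIntegralModel v)).map (algebraMap (v.adicCompletionIntegers K) (v.adicCompletion K))).a₁ ≤ exp (-(k₁ : ℤ)) := by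
    rw [map_a₁, ValuationSubring.algebraMap_apply]; exact hpow _ _ h₁
  have hJ₂ : Valued.v ((D • (W.localMinimalIntegralModel v)).map (algebraMap (v.adicCompletionIntegers K) (v.adicCompletion K))).a₂ ≤ exp (-(k₂ : ℤ)) := by
    rw [map_a₂, ValuationSubring.algebraMap_apply]; exact hpow _ _ h₂
  have hJ₃ : Valued.v ((D • (W.localMinimalIntegralModel v)).map (algebraMap (v.adicCompletionIntegers K) (v.adicCompletion K))).a₃ ≤ exp (-(k₃ : ℤ)) := by
    rw [map_a₃, ValuationSubring.algebraMap_apply]; exact hpow _ _ h₃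
  have hJ₄ : Valued.v ((D • (W.localMinimalIntegralModel v)).map (algebraMap (v.adicCompletionIntegers K) (v.adicCompletion K))).a₄ ≤ exp (-(k₄ : ℤ)) := by
    rw [map_a₄, ValuationSubring.algebraMap_apply]; exact hpow _ _ h₄
  have hJ₆ : Valued.v ((D • (W.localMinimalIntegralModel v)).map (algebraMap (v.adicCompletionIntegers K) (v.adicCompletion K))).a₆ ≤ exp (-(k₆ : ℤ)) := by
    rw [map_a₆, ValuationSubring.algebraMap_apply]; exact hpow _ _ h₆
  have hle1 : ∀ k : ℕ, exp (-(k : ℤ)) ≤ (1 : ℤᵐ⁰) := fun k => by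
    rw [← exp_zero, exp_le_exp]; omega
  obtain ⟨hA₁, hA₂, hA₃, hA₄, hA₆, hAΔ⟩ :=
    valuation_variableChange_le_max (Valued.v : Valuation (v.adicCompletion K) ℤᵐ⁰)
      ((D • (W.localMinimalIntegralModel v)).map (algebraMap (v.adicCompletionIntegers K) (v.adicCompletion K)))
      (C.baseChange (v.adicCompletion K) * (D.map (algebraMap (v.adicCompletionIntegers K) (v.adicCompletion K)) *
        ((W.baseChange (v.adicCompletion K)).exists_isMinimal (v.adicCompletionIntegers K)).choose)⁻¹) hu hε1 hr hs ht
      (hJ₁.trans (hle1 _)) (hJ₂.trans (hle1 _)) (hJ₃.trans (hle1 _)) (hJ₄.trans (hle1 _))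
  -- reading the `K`-coefficients of `C • W` in `K_v`
  have hcoef : ∀ x : K, v.valuation K x = Valued.v (algebraMap K (v.adicCompletion K) x) := fun x =>
    (valuedAdicCompletion_eq_valuation' v x).symm
  have hb₁ : ((C • W).baseChange (v.adicCompletion K)).a₁ = algebraMap K (v.adicCompletion K) (C • W).a₁ := by
    rw [baseChange, map_a₁]
  have hb₂ : ((C • W).baseChange (v.adicCompletion K)).a₂ = algebraMap K (v.adicCompletion K) (C • W).a₂ := by
    rw [baseChange, map_a₂]
  have hb₃ : ((C • W).baseChange (v.adicCompletion K)).a₃ = algebraMap K (v.adicCompletion K) (C • W).a₃ := by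
    rw [baseChange, map_a₃]
  have hb₄ : ((C • W).baseChange (v.adicCompletion K)).a₄ = algebraMap K (v.adicCompletion K) (C • W).a₄ := by
    rw [baseChange, map_a₄]
  have hb₆ : ((C • W).baseChange (v.adicCompletion K)).a₆ = algebraMap K (v.adicCompletion K) (C • W).a₆ := by
    rw [baseChange, map_a₆]
  have hbΔ : ((C • W).baseChange (v.adicCompletion K)).Δ = algebraMap K (v.adicCompletion K) (C • W).Δ := by
    rw [baseChange, map_Δ]
  refine ⟨C, ?_, ?_, ?_, ?_, ?_, ?_⟩
  · rw [hcoef, ← hb₁, hCW]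
    exact hA₁.trans (max_le hJ₁ (hεk k₁ (by omega)))
  · rw [hcoef, ← hb₂, hCW]
    exact hA₂.trans (max_le hJ₂ (hεk k₂ (by omega)))
  · rw [hcoef, ← hb₃, hCW]
    exact hA₃.trans (max_le hJ₃ (hεk k₃ (by omega)))
  · rw [hcoef, ← hb₄, hCW]
    exact hA₄.trans (max_le hJ₄ (hεk k₄ (by omega)))
  · rw [hcoef, ← hb₆, hCW]
    exact hA₆.trans (max_le hJ₆ (hεk k₆ (by omega)))
  · -- `|Δ(C • W)|_v = |Δ(J)| = |Δ(V)| = exp (−ord_v Δ_min)`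
    have hDu : Valued.v ((↑D.u⁻¹ : v.adicCompletionIntegers K) : v.adicCompletion K) = 1 :=
      adicCompletionIntegers.isUnit_iff_valued_eq_one.mp (Units.isUnit D.u⁻¹)
    have hVΔ0 : (W.localMinimalIntegralModel v).Δ ≠ 0 := by
      intro h0
      have : ((W.localMinimalIntegralModel v).map (algebraMap (v.adicCompletionIntegers K) (v.adicCompletion K))).Δ = 0 := by
        rw [map_Δ, h0, map_zero]
      rw [← hmin, variableChange_Δ] at this
      exact (mul_ne_zero (pow_ne_zero _ (Units.ne_zero _))
        (WeierstrassCurve.isUnit_Δ (W := W.baseChange (v.adicCompletion K))).ne_zero) this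
    obtain ⟨n, hn, hvn⟩ :=
      HeightOneSpectrum.exists_addVal_adicCompletionIntegers_eq K v (W.localMinimalIntegralModel v).Δ hVΔ0
    have hord : W.ordMinimalDiscriminant v = n := by
      rw [WeierstrassCurve.ordMinimalDiscriminant, hn]; rfl
    rw [hcoef, ← hbΔ, hCW, hAΔ, map_Δ, variableChange_Δ, map_mul, map_pow,
      ValuationSubring.algebraMap_apply, ValuationSubring.algebraMap_apply, map_mul, map_pow, hDu,
      one_pow, one_mul, hord]
    exact hvn

end RationalNormalForm

/-! ## §4. The Tate normal forms of types III and III* over `K`, at a place `v ∤ 2` -/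

section NormalForms

open Literature.NumberTheory.DiophantineGeometry Literature.NumberTheory.EllipticCurves

variable {A : Type*} [CommRing A] [IsDedekindDomain A] {K : Type*} [Field K] [Algebra A K]
  [IsFractionRing A K] (v : HeightOneSpectrum A) (W : WeierstrassCurve K)

/-- **Type III, rationally.** If Tate's algorithm at `v ∤ 2` returns III (perfect residue field), some
`K`-rational equation `C • W` has `v(a₁), v(a₂), v(a₃), v(a₄) ≥ 1`, `v(a₆) ≥ 2` and `v(Δ) = 3`
(Silverman *ATAEC* IV.9.4 Step 4 and Table 4.1: `ord Δ = m + 1 = 3`; the local normal form is the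
tree's `LocalIndex.exists_smul_of_kodairaSymbolOfMinimal_eq_III`, made `K`-rational by §3).
[cite: SilvermanATAEC1994, IV.9.4 Step 4 and Table 4.1 (type III: v(Δ) = 3)] -/
theorem exists_variableChange_tateNormalForm_III [W.IsElliptic]
    [PerfectField (IsLocalRing.ResidueField (v.adicCompletionIntegers K))]
    (h2 : ringChar (A ⧸ v.asIdeal) ≠ 2) (hK : W.kodairaSymbolAt v = .III) :
    ∃ C : VariableChange K,
      v.valuation K (C • W).a₁ ≤ exp (-1 : ℤ) ∧ v.valuation K (C • W).a₂ ≤ exp (-1 : ℤ) ∧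
      v.valuation K (C • W).a₃ ≤ exp (-1 : ℤ) ∧ v.valuation K (C • W).a₄ ≤ exp (-1 : ℤ) ∧
      v.valuation K (C • W).a₆ ≤ exp (-2 : ℤ) ∧ v.valuation K (C • W).Δ = exp (-3 : ℤ) := by
  have hKV : (W.localMinimalIntegralModel v).kodairaSymbolOfMinimal = .III := by
    rw [← kodairaSymbolAt_def]; exact hK
  obtain ⟨D, h₁, h₂, h₃, h₄, -, h₆⟩ :=
    LocalIndex.exists_smul_of_kodairaSymbolOfMinimal_eq_III _ hKV
  have hord : W.ordMinimalDiscriminant v = 3 := by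
    have h := W.ordMinimalDiscriminant_eq_numComponentsAt_add_one_of_kodairaSymbolAt v h2 (Or.inl hK)
    unfold numComponentsAt at h
    rw [hK] at h
    exact h
  obtain ⟨C, c₁, c₂, c₃, c₄, c₆, cΔ⟩ := W.exists_variableChange_valuation_le_of_localModel v D
    (k₁ := 1) (k₂ := 1) (k₃ := 1) (k₄ := 1) (k₆ := 2)
    (by rwa [pow_one]) (by rwa [pow_one]) (by rwa [pow_one]) (by rwa [pow_one]) h₆
  refine ⟨C, by simpa using c₁, by simpa using c₂, by simpa using c₃, by simpa using c₄,
    by simpa using c₆, ?_⟩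
  rw [cΔ, hord]; rfl

/-- **Type III*, rationally.** If Tate's algorithm at `v ∤ 2` returns III*, some `K`-rational equation
`C • W` has `v(a₁) ≥ 1`, `v(a₂) ≥ 2`, `v(a₃) ≥ 3`, `v(a₄) ≥ 3`, `v(a₆) ≥ 5` and `v(Δ) = 9`
(Silverman *ATAEC* IV.9.4 Step 9 and Table 4.1: `ord Δ = m + 1 = 9`; local normal form
`LocalIndex.exists_smul_of_kodairaSymbolOfMinimal_eq_IIIstar`).
[cite: SilvermanATAEC1994, IV.9.4 Step 9 and Table 4.1 (type III*: v(Δ) = 9)] -/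
theorem exists_variableChange_tateNormalForm_IIIstar [W.IsElliptic]
    [PerfectField (IsLocalRing.ResidueField (v.adicCompletionIntegers K))]
    (h2 : ringChar (A ⧸ v.asIdeal) ≠ 2) (hK : W.kodairaSymbolAt v = .IIIstar) :
    ∃ C : VariableChange K,
      v.valuation K (C • W).a₁ ≤ exp (-1 : ℤ) ∧ v.valuation K (C • W).a₂ ≤ exp (-2 : ℤ) ∧
      v.valuation K (C • W).a₃ ≤ exp (-3 : ℤ) ∧ v.valuation K (C • W).a₄ ≤ exp (-3 : ℤ) ∧
      v.valuation K (C • W).a₆ ≤ exp (-5 : ℤ) ∧ v.valuation K (C • W).Δ = exp (-9 : ℤ) := by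
  have hKV : (W.localMinimalIntegralModel v).kodairaSymbolOfMinimal = .IIIstar := by
    rw [← kodairaSymbolAt_def]; exact hK
  obtain ⟨D, h₁, h₂, h₃, h₄, -, h₆⟩ :=
    LocalIndex.exists_smul_of_kodairaSymbolOfMinimal_eq_IIIstar _ hKV
  have hord : W.ordMinimalDiscriminant v = 9 := by
    have h := W.ordMinimalDiscriminant_eq_numComponentsAt_add_one_of_kodairaSymbolAt v h2
      (Or.inr (Or.inl hK))
    unfold numComponentsAt at h
    rw [hK] at h
    exact h
  obtain ⟨C, c₁, c₂, c₃, c₄, c₆, cΔ⟩ := W.exists_variableChange_valuation_le_of_localModel v D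
    (k₁ := 1) (k₂ := 2) (k₃ := 3) (k₄ := 3) (k₆ := 5)
    (by rwa [pow_one]) h₂ h₃ h₄ h₆
  refine ⟨C, by simpa using c₁, by simpa using c₂, by simpa using c₃, by simpa using c₄,
    by simpa using c₆, ?_⟩
  rw [cΔ, hord]; rfl

end NormalForms

/-! ## §5. Over a number field containing `p^{1/4}`: good reduction above `p` on the III / III* rows -/

section Scaling

variable {L : Type*} [Field L] (X : WeierstrassCurve L) (U : Lˣ)

/-- The pure rescaling `(u, 0, 0, 0)`: `aᵢ ↦ u⁻ⁱ aᵢ`, `Δ ↦ u⁻¹² Δ` (Silverman *AEC* III Table 3.1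
with `r = s = t = 0`). [cite: SilvermanAEC2009, III §1 Table 3.1] -/
theorem variableChange_rescale_eq :
    ((⟨U, 0, 0, 0⟩ : VariableChange L) • X).a₁ = ↑U⁻¹ * X.a₁ ∧
    ((⟨U, 0, 0, 0⟩ : VariableChange L) • X).a₂ = ↑U⁻¹ ^ 2 * X.a₂ ∧
    ((⟨U, 0, 0, 0⟩ : VariableChange L) • X).a₃ = ↑U⁻¹ ^ 3 * X.a₃ ∧
    ((⟨U, 0, 0, 0⟩ : VariableChange L) • X).a₄ = ↑U⁻¹ ^ 4 * X.a₄ ∧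
    ((⟨U, 0, 0, 0⟩ : VariableChange L) • X).a₆ = ↑U⁻¹ ^ 6 * X.a₆ ∧
    ((⟨U, 0, 0, 0⟩ : VariableChange L) • X).Δ = ↑U⁻¹ ^ 12 * X.Δ := by
  refine ⟨?_, ?_, ?_, ?_, ?_, ?_⟩
  · rw [variableChange_a₁]; ring
  · rw [variableChange_a₂]; ring
  · rw [variableChange_a₃]; ring
  · rw [variableChange_a₄]; ring
  · rw [variableChange_a₆]; ring
  · rw [variableChange_Δ]

end Scaling

section NumberFieldWitness

open Rat.HeightOneSpectrum NumberField Literature.NumberTheory.EllipticCurves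

variable (W : WeierstrassCurve ℚ) [W.IsElliptic] {p : ℕ} (v : HeightOneSpectrum ℤ)

/-- Place bookkeeping: a place `w ∋ p` of a number field `F` lies over the place `v` of `ℤ` with
`primesEquiv v = p`. [folklore] -/
private theorem liesOver_of_natCast_mem' (hv : ((primesEquiv (R := ℤ) v : Nat.Primes) : ℕ) = p)
    {F : Type*} [Field F] (w : HeightOneSpectrum (𝓞 F)) (hw : (p : 𝓞 F) ∈ w.asIdeal) :
    w.asIdeal.LiesOver v.asIdeal := by
  have hgen : natGenerator v = p := hv
  have hvspan : v.asIdeal = Ideal.span {(p : ℤ)} := by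
    rw [asIdeal_eq_span_natGenerator_int, hgen]
  have hle : v.asIdeal ≤ w.asIdeal.under ℤ := by
    rw [hvspan, Ideal.span_le, Set.singleton_subset_iff, SetLike.mem_coe, Ideal.under_def,
      Ideal.mem_comap, map_natCast]
    exact hw
  exact ⟨((v.isMaximal.eq_of_le (Ideal.IsPrime.ne_top inferInstance) hle).symm).symm⟩

/-- The residue ring `ℤ ⧸ v` has characteristic `natGenerator v`. [folklore] -/
private theorem ringChar_int_quot_eq (v : HeightOneSpectrum ℤ) :
    ringChar (ℤ ⧸ v.asIdeal) = natGenerator v := by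
  have hmem : (natGenerator v : ℤ) ∈ v.asIdeal := by
    rw [asIdeal_eq_span_natGenerator_int]; exact Ideal.mem_span_singleton_self _
  haveI : Nontrivial (ℤ ⧸ v.asIdeal) := Ideal.Quotient.nontrivial_iff.mpr v.isPrime.ne_top
  apply CharP.ringChar_of_prime_eq_zero (prime_natGenerator v)
  rw [← map_natCast (Ideal.Quotient.mk v.asIdeal), Ideal.Quotient.eq_zero_iff_mem]
  exact hmem

omit [W.IsElliptic] in
/-- **The scaled model over a field containing `p^{1/4}`.** Technical heart of the witness: `W/ℚ`
elliptic, `v` the place of `ℤ` over the prime `p`, `C • W` a `ℚ`-rational equation with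
`v(aᵢ) ≥ kᵢ` and `v(Δ) = d`; `F` a number field with `θ ∈ F`, `θ⁴ = p`, `w ∋ p` a place of `F`;
`j ∈ ℕ` with `i·j ≤ 4 kᵢ` (`i = 1, 2, 3, 4, 6`) and `d = 3 j`. Then the rescaling of `(C • W)_F` by
`u = θ^j` is `w`-integral with `w`-UNIT discriminant, so `W_F` has GOOD reduction at `w`
(`|θ|_w = |ϖ_w|^{e/4}` from `θ⁴ = p`, `|x|_w = |x|_v^e` on `ℚ`; Silverman *AEC* VII.1 Remark 1.1 and
VII.5.1 (a)). For III take `(kᵢ) = (1,1,1,1,2)`, `d = 3`, `j = 1`; for III* `(1,2,3,3,5)`, `d = 9`,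
`j = 3` ([FreitasKraus2022] §4: "`L = ℚ_ℓ^{un}F`, `F = ℚ_ℓ(π)`, `π⁴ = ℓ` … the change of variables
`x = π²X`, `y = π³Y` … is a model with good reduction"). [cite: SilvermanAEC2009, VII.1 Remark 1.1 and VII.5 Prop. 5.1 (a)] [cite: FreitasKraus2022, §4 (proof of Lemma 13, held text arXiv:1607.01218 chunk p0032 L11–40)] -/
theorem hasGoodReductionAt_baseChange_of_pow_four_eq_of_profile
    (hv : ((primesEquiv (R := ℤ) v : Nat.Primes) : ℕ) = p) {C : VariableChange ℚ}
    {k₁ k₂ k₃ k₄ k₆ d j : ℕ}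
    (c₁ : v.valuation ℚ (C • W).a₁ ≤ exp (-(k₁ : ℤ))) (c₂ : v.valuation ℚ (C • W).a₂ ≤ exp (-(k₂ : ℤ)))
    (c₃ : v.valuation ℚ (C • W).a₃ ≤ exp (-(k₃ : ℤ))) (c₄ : v.valuation ℚ (C • W).a₄ ≤ exp (-(k₄ : ℤ)))
    (c₆ : v.valuation ℚ (C • W).a₆ ≤ exp (-(k₆ : ℤ)))
    (cΔ : v.valuation ℚ (C • W).Δ = exp (-(d : ℤ)))
    (hk₁ : j ≤ 4 * k₁) (hk₂ : 2 * j ≤ 4 * k₂) (hk₃ : 3 * j ≤ 4 * k₃) (hk₄ : 4 * j ≤ 4 * k₄)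
    (hk₆ : 6 * j ≤ 4 * k₆) (hd : d = 3 * j)
    {F : Type*} [Field F] [NumberField F] {θ : F} (hθ : θ ^ 4 = p)
    (w : HeightOneSpectrum (𝓞 F)) (hw : (p : 𝓞 F) ∈ w.asIdeal) :
    (W.baseChange F).HasGoodReductionAt w := by
  haveI : w.asIdeal.LiesOver v.asIdeal := liesOver_of_natCast_mem' v hv w hw
  have hgen : natGenerator v = p := hv
  have hp : p.Prime := hgen ▸ prime_natGenerator v
  -- valuations on `ℚ ⊆ F`
  have hval : ∀ x : ℚ, w.valuation F (algebraMap ℚ F x) =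
      v.valuation ℚ x ^ v.asIdeal.ramificationIdx' w.asIdeal := fun x =>
    (IsDedekindDomain.HeightOneSpectrum.valuation_liesOver F v w x).symm
  set e : ℕ := v.asIdeal.ramificationIdx' w.asIdeal with he
  have hvp : v.valuation ℚ (p : ℚ) = exp (-1 : ℤ) := by
    rw [← hgen]; exact valuation_natGenerator_int v
  -- `|θ|_w = exp a` with `4 a = -e`
  have hθ0 : θ ≠ 0 := by
    rintro rfl
    rw [zero_pow four_ne_zero] at hθ
    exact hp.ne_zero (by exact_mod_cast hθ.symm)
  have hwθ0 : w.valuation F θ ≠ 0 := (Valuation.ne_zero_iff _).mpr hθ0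
  set a : ℤ := log (w.valuation F θ) with ha
  have hθa : w.valuation F θ = exp a := (exp_log hwθ0).symm
  have h4a : 4 * a = -(e : ℤ) := by
    have h := congrArg (w.valuation F) hθ
    rw [map_pow, hθa, ← exp_nsmul, show ((p : ℕ) : F) = algebraMap ℚ F (p : ℚ) by
      rw [map_natCast], hval, hvp, ← exp_nsmul, exp_inj] at h
    simpa using h
  -- the rescaled model `Y = (θ^j, 0, 0, 0) • (C • W)_F`
  set U : Fˣ := Units.mk0 (θ ^ j) (pow_ne_zero _ hθ0) with hU
  set X := (C • W).baseChange F with hX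
  set Y := (⟨U, 0, 0, 0⟩ : VariableChange F) • X with hY
  obtain ⟨y₁, y₂, y₃, y₄, y₆, yΔ⟩ := variableChange_rescale_eq X U
  have hUval : ∀ i : ℕ, w.valuation F ((↑U⁻¹ : F) ^ i) = exp (-((i * j : ℕ) : ℤ) * a) := by
    intro i
    rw [Units.val_inv_eq_inv_val, hU, Units.val_mk0, map_pow, map_inv₀, map_pow, hθa,
      ← exp_nsmul, ← exp_neg, ← exp_nsmul]
    congr 1
    push_cast
    ring
  have hXa : ∀ {x : ℚ} {k : ℕ}, v.valuation ℚ x ≤ exp (-(k : ℤ)) →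
      w.valuation F (algebraMap ℚ F x) ≤ exp (-((k * e : ℕ) : ℤ)) := by
    intro x k hx
    rw [hval]
    calc v.valuation ℚ x ^ e ≤ exp (-(k : ℤ)) ^ e := pow_le_pow_left₀ zero_le hx e
      _ = exp (-((k * e : ℕ) : ℤ)) := by rw [← exp_nsmul]; congr 1; push_cast; ring
  -- each coefficient of `Y` is `w`-integral
  have hcoef : ∀ {i k : ℕ} {x : ℚ}, i * j ≤ 4 * k → v.valuation ℚ x ≤ exp (-(k : ℤ)) →
      w.valuation F ((↑U⁻¹ : F) ^ i * algebraMap ℚ F x) ≤ 1 := by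
    intro i k x hik hx
    rw [map_mul, hUval]
    calc exp (-((i * j : ℕ) : ℤ) * a) * w.valuation F (algebraMap ℚ F x)
        ≤ exp (-((i * j : ℕ) : ℤ) * a) * exp (-((k * e : ℕ) : ℤ)) := mul_le_mul' le_rfl (hXa hx)
      _ = exp (-((i * j : ℕ) : ℤ) * a - ((k * e : ℕ) : ℤ)) := by rw [← exp_add]; rfl
      _ ≤ exp 0 := by
          rw [exp_le_exp]
          have : ((k * e : ℕ) : ℤ) = -(4 * a) * k := by push_cast; rw [h4a]; ring
          rw [this]
          have hik' : ((i * j : ℕ) : ℤ) ≤ 4 * k := by exact_mod_cast hik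
          have ha0 : a ≤ 0 := by
            have : (0 : ℤ) < e := by
              exact_mod_cast Nat.pos_of_ne_zero
                (Ideal.IsDedekindDomain.ramificationIdx'_ne_zero_of_liesOver w.asIdeal v.ne_bot)
            omega
          nlinarith
      _ = 1 := exp_zero
  have hX₁ : X.a₁ = algebraMap ℚ F (C • W).a₁ := by rw [hX, baseChange, map_a₁]
  have hX₂ : X.a₂ = algebraMap ℚ F (C • W).a₂ := by rw [hX, baseChange, map_a₂]
  have hX₃ : X.a₃ = algebraMap ℚ F (C • W).a₃ := by rw [hX, baseChange, map_a₃]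
  have hX₄ : X.a₄ = algebraMap ℚ F (C • W).a₄ := by rw [hX, baseChange, map_a₄]
  have hX₆ : X.a₆ = algebraMap ℚ F (C • W).a₆ := by rw [hX, baseChange, map_a₆]
  have hXΔ : X.Δ = algebraMap ℚ F (C • W).Δ := by rw [hX, baseChange, map_Δ]
  have hint : Y.IsIntegralAt w := by
    rw [isIntegralAt_iff_valuation_le_one]
    refine ⟨?_, ?_, ?_, ?_, ?_⟩
    · rw [hY, y₁, ← pow_one (↑U⁻¹ : F), hX₁]; exact hcoef (by omega) c₁
    · rw [hY, y₂, hX₂]; exact hcoef hk₂ c₂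
    · rw [hY, y₃, hX₃]; exact hcoef hk₃ c₃
    · rw [hY, y₄, hX₄]; exact hcoef hk₄ c₄
    · rw [hY, y₆, hX₆]; exact hcoef hk₆ c₆
  -- the discriminant of `Y` is a `w`-unit
  have hΔ : w.valuation F Y.Δ = 1 := by
    rw [hY, yΔ, hXΔ, map_mul, hUval, hval, cΔ, ← exp_nsmul, ← exp_add, ← exp_zero, exp_inj,
      nsmul_eq_mul]
    have hd' : (d : ℤ) = 3 * j := by exact_mod_cast hd
    have he' : (e : ℤ) = -(4 * a) := by rw [h4a]; ring
    push_cast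
    rw [hd', he']
    ring
  have hgoodY : Y.HasGoodReductionAt w := hasGoodReductionAt_of_valuation_Δ_eq_one_holds w Y hint hΔ
  have hgoodX : X.HasGoodReductionAt w := (hasGoodReductionAt_smul_iff_holds w X _).mp (hY ▸ hgoodY)
  rw [hX, baseChange_smul_eq] at hgoodX
  exact (hasGoodReductionAt_smul_iff_holds w (W.baseChange F) _).mp hgoodX

/-- **Good reduction over any number field containing `p^{1/4}`, on the III / III* rows at an odd
prime `p`.** For `W/ℚ` elliptic with Kodaira type III or III* at the place `v` of `ℤ` over `p ≠ 2`,
every number field `F` with an element `θ`, `θ⁴ = p`, and every place `w ∋ p` of `F`: `W_F` has GOOD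
reduction at `w` (Silverman *ATAEC* IV Table 4.1 normal forms rescaled by `θ`, resp. `θ³`;
[FreitasKraus2022] §4: for `e = 4`, "`E` gets good reduction" over `ℚ_ℓ^{un}(ℓ^{1/4})`).
[cite: FreitasKraus2022, §4 first paragraph and proof of Lemma 13 (arXiv:1607.01218 chunk p0032 L11–40)] [cite: SilvermanATAEC1994, IV.9.4 Steps 4 and 9, Table 4.1] -/
theorem hasGoodReductionAt_baseChange_of_pow_four_eq_of_kodairaSymbolAt_eq_III_or_IIIstar
    (hv : ((primesEquiv (R := ℤ) v : Nat.Primes) : ℕ) = p) (hp2 : p ≠ 2)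
    (hK : W.kodairaSymbolAt v = .III ∨ W.kodairaSymbolAt v = .IIIstar)
    {F : Type*} [Field F] [NumberField F] {θ : F} (hθ : θ ^ 4 = p)
    (w : HeightOneSpectrum (𝓞 F)) (hw : (p : 𝓞 F) ∈ w.asIdeal) :
    (W.baseChange F).HasGoodReductionAt w := by
  haveI : PerfectField (IsLocalRing.ResidueField (v.adicCompletionIntegers ℚ)) :=
    PerfectField.ofFinite
  have hgen : natGenerator v = p := hv
  have h2 : ringChar (ℤ ⧸ v.asIdeal) ≠ 2 := by rw [ringChar_int_quot_eq v, hgen]; exact hp2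
  rcases hK with hK | hK
  · obtain ⟨C, c₁, c₂, c₃, c₄, c₆, cΔ⟩ := W.exists_variableChange_tateNormalForm_III v h2 hK
    exact W.hasGoodReductionAt_baseChange_of_pow_four_eq_of_profile v hv
      (k₁ := 1) (k₂ := 1) (k₃ := 1) (k₄ := 1) (k₆ := 2) (d := 3) (j := 1)
      (by simpa using c₁) (by simpa using c₂) (by simpa using c₃) (by simpa using c₄)
      (by simpa using c₆) (by simpa using cΔ)
      (by norm_num) (by norm_num) (by norm_num) (by norm_num) (by norm_num) (by norm_num) hθ w hw
  · obtain ⟨C, c₁, c₂, c₃, c₄, c₆, cΔ⟩ := W.exists_variableChange_tateNormalForm_IIIstar v h2 hK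
    exact W.hasGoodReductionAt_baseChange_of_pow_four_eq_of_profile v hv
      (k₁ := 1) (k₂ := 2) (k₃ := 3) (k₄ := 3) (k₆ := 5) (d := 9) (j := 3)
      (by simpa using c₁) (by simpa using c₂) (by simpa using c₃) (by simpa using c₄)
      (by simpa using c₆) (by simpa using cΔ)
      (by norm_num) (by norm_num) (by norm_num) (by norm_num) (by norm_num) (by norm_num) hθ w hw

end NumberFieldWitness

/-! ## §6. The witness of index `4` and the defect on the III / III* rows -/

section Field

open Polynomial

/-- **A number field of degree `≤ 4` containing a fourth root of `p`**: `F = ℚ[X]/(f)` for `f` the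
minimal polynomial over `ℚ` of a root `θ₀ ∈ ℚ̄` of `X⁴ − p` (so `f ∣ X⁴ − p`, `[F : ℚ] = deg f ≤ 4`;
in fact `X⁴ − p` is `p`-Eisenstein and `F = ℚ(p^{1/4})` has degree `4`, which we do not need).
[folklore] -/
private theorem exists_numberField_pow_four_eq_natCast (p : ℕ) :
    ∃ (F : Type) (_ : Field F) (_ : NumberField F) (θ : F), θ ^ 4 = p ∧ Module.finrank ℚ F ≤ 4 := by
  obtain ⟨θ₀, hθ₀⟩ :=
    IsAlgClosed.exists_pow_nat_eq ((p : ℕ) : AlgebraicClosure ℚ) (by norm_num : 0 < 4)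
  set g : ℚ[X] := X ^ 4 - C (p : ℚ) with hg
  have hg0 : g ≠ 0 := X_pow_sub_C_ne_zero (by norm_num) _
  have hgθ : aeval θ₀ g = 0 := by simp [hg, hθ₀]
  have halg : IsAlgebraic ℚ θ₀ := ⟨g, hg0, hgθ⟩
  have hint : _root_.IsIntegral ℚ θ₀ := halg.isIntegral
  haveI : Fact (Irreducible (minpoly ℚ θ₀)) := ⟨minpoly.irreducible hint⟩
  have hfg : minpoly ℚ θ₀ ∣ g := minpoly.dvd ℚ θ₀ hgθ
  have hf0 : minpoly ℚ θ₀ ≠ 0 := minpoly.ne_zero hint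
  refine ⟨AdjoinRoot (minpoly ℚ θ₀), inferInstance, inferInstance, AdjoinRoot.root (minpoly ℚ θ₀),
    ?_, ?_⟩
  · obtain ⟨q, hq⟩ := hfg
    have h : g.eval₂ (AdjoinRoot.of (minpoly ℚ θ₀)) (AdjoinRoot.root (minpoly ℚ θ₀)) = 0 := by
      rw [hq, eval₂_mul, AdjoinRoot.eval₂_root, zero_mul]
    rw [hg, eval₂_sub, eval₂_X_pow, eval₂_C, map_natCast, sub_eq_zero] at h
    exact h
  · have h1 := (AdjoinRoot.powerBasis hf0).finrank
    have h2 : (AdjoinRoot.powerBasis hf0).dim = (minpoly ℚ θ₀).natDegree := rfl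
    have h3 : (minpoly ℚ θ₀).natDegree ≤ 4 :=
      (natDegree_le_of_dvd hfg hg0).trans (by rw [hg, natDegree_X_pow_sub_C])
    have key : Module.finrank ℚ (AdjoinRoot (minpoly ℚ θ₀)) ≤ 4 := by rw [h1, h2]; exact h3
    convert key

end Field

section Defect

open Rat.HeightOneSpectrum NumberField Literature.NumberTheory.EllipticCurves
  Literature.NumberTheory.DiophantineGeometry

variable (W : WeierstrassCurve ℚ) [W.IsElliptic] {p : ℕ} (v : HeightOneSpectrum ℤ)

/-- `ord_p Δ_min = 3` or `9` on the Kodaira III / III* rows at an odd prime `p` (Silverman *ATAEC*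
IV Table 4.1, `ord Δ = m + 1`; the tree's tame-type theorem
`ordMinimalDiscriminant_eq_numComponentsAt_add_one_of_kodairaSymbolAt`).
[cite: SilvermanATAEC1994, IV.9 Table 4.1 (types III, III*)] -/
theorem ordMinimalDiscriminant_eq_three_or_nine_of_kodairaSymbolAt_eq_III_or_IIIstar_of_ne_two
    (hv : ((primesEquiv (R := ℤ) v : Nat.Primes) : ℕ) = p) (hp2 : p ≠ 2)
    (hK : W.kodairaSymbolAt v = .III ∨ W.kodairaSymbolAt v = .IIIstar) :
    W.ordMinimalDiscriminant v = 3 ∨ W.ordMinimalDiscriminant v = 9 := by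
  haveI : PerfectField (IsLocalRing.ResidueField (v.adicCompletionIntegers ℚ)) :=
    PerfectField.ofFinite
  have hgen : natGenerator v = p := hv
  have h2 : ringChar (ℤ ⧸ v.asIdeal) ≠ 2 := by rw [ringChar_int_quot_eq v, hgen]; exact hp2
  have hn := W.ordMinimalDiscriminant_eq_numComponentsAt_add_one_of_kodairaSymbolAt v h2
    (hK.elim Or.inl fun h9 => Or.inr (Or.inl h9))
  unfold WeierstrassCurve.numComponentsAt at hn
  rcases hK with hK | hK
  · left; rw [hn, hK]; rfl
  · right; rw [hn, hK]; rfl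

/-- Every number field has a finite place above the rational prime `p` (a maximal ideal of `𝓞 F`
over `(p)`, Mathlib `Ideal.exists_maximal_ideal_liesOver_of_isIntegral`). [folklore] -/
private theorem exists_heightOneSpectrum_natCast_mem (F : Type*) [Field F] [NumberField F] {p : ℕ}
    (hp : p.Prime) : ∃ w : HeightOneSpectrum (𝓞 F), (p : 𝓞 F) ∈ w.asIdeal := by
  have hp0 : Ideal.span {(p : ℤ)} ≠ ⊥ := by
    rw [Ne, Ideal.span_singleton_eq_bot]; exact_mod_cast hp.ne_zero
  haveI : (Ideal.span {(p : ℤ)}).IsMaximal :=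
    ((Ideal.span_singleton_prime (by exact_mod_cast hp.ne_zero)).mpr
      (Nat.prime_iff_prime_int.mp hp)).isMaximal hp0
  obtain ⟨Q, hQmax, hQover⟩ :=
    Ideal.exists_maximal_ideal_liesOver_of_isIntegral (S := 𝓞 F) (Ideal.span {(p : ℤ)})
  have hQ0 : Q ≠ ⊥ := Ideal.ne_bot_of_liesOver_of_ne_bot hp0 Q
  refine ⟨⟨Q, hQmax.isPrime, hQ0⟩, ?_⟩
  have h : algebraMap ℤ (𝓞 F) (p : ℤ) ∈ Q := by
    rw [← Ideal.mem_comap, ← Ideal.under_def, ← hQover.over]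
    exact Ideal.mem_span_singleton_self _
  rwa [map_natCast] at h

/-- **The witness of index `4`.** For `W/ℚ` elliptic with Kodaira type III or III* at the place `v`
of `ℤ` over an odd prime `p`, there IS a semistability witness of index `4` at `p` in the sense of
`SemistabilityDefect.lean`: the number field `F = ℚ(θ)`, `θ⁴ = p`, `[F : ℚ] ≤ 4`, and any place
`w ∋ p` of `F` — `W_F` has good reduction at `w` (§5) and `e(w ∣ p) = 4`, because `e(w ∣ p) ≤ [F : ℚ] ≤ 4`
(Mathlib `Ideal.ramificationIdx_le_finrank`) while good reduction forces `4 = 12 / gcd(12, ord_p Δ_min)`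
to divide `e(w ∣ p)` (`twelve_dvd_ramificationIdx_mul_ordMinimalDiscriminant_of_hasGoodReductionAt_baseChange`).
[FreitasKraus2022] §4: "`L = ℚ_ℓ^{un}F` is the minimal extension of `ℚ_ℓ^{un}` where `E` gets good
reduction; it is also the unique degree `4` tame extension of `ℚ_ℓ^{un}`".
[cite: FreitasKraus2022, §4 first paragraph (held text arXiv:1607.01218 chunk p0032 L11–17)] [cite: SilvermanAEC2009, VII.5 Prop. 5.5 (proof) and VII.1 Prop. 1.3] -/
theorem isSemistabilityWitnessAt_four_of_kodairaSymbolAt_eq_III_or_IIIstar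
    (hv : ((primesEquiv (R := ℤ) v : Nat.Primes) : ℕ) = p) (hp2 : p ≠ 2)
    (hK : W.kodairaSymbolAt v = .III ∨ W.kodairaSymbolAt v = .IIIstar) :
    W.IsSemistabilityWitnessAt p 4 := by
  have hgen : natGenerator v = p := hv
  have hp : p.Prime := hgen ▸ prime_natGenerator v
  obtain ⟨F, _, _, θ, hθ, hF⟩ := exists_numberField_pow_four_eq_natCast p
  obtain ⟨w, hw⟩ := exists_heightOneSpectrum_natCast_mem F hp
  have hgood := W.hasGoodReductionAt_baseChange_of_pow_four_eq_of_kodairaSymbolAt_eq_III_or_IIIstar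
    v hv hp2 hK hθ w hw
  -- `e(w ∣ p) = 4`
  haveI : w.asIdeal.LiesOver v.asIdeal := liesOver_of_natCast_mem' v hv w hw
  haveI := w.isPrime
  haveI := v.isMaximal
  have h12 := W.twelve_dvd_ramificationIdx_mul_ordMinimalDiscriminant_of_hasGoodReductionAt_baseChange
    F (v := v) (w := w) hgood
  have h4 : 4 ∣ v.asIdeal.ramificationIdx' w.asIdeal := by
    rcases W.ordMinimalDiscriminant_eq_three_or_nine_of_kodairaSymbolAt_eq_III_or_IIIstar_of_ne_two
      v hv hp2 hK with h3 | h9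
    · rw [h3] at h12; omega
    · rw [h9] at h12; omega
  have hle : v.asIdeal.ramificationIdx' w.asIdeal ≤ 4 :=
    (Ideal.ramificationIdx_le_finrank (𝓞 F) ℚ F w.asIdeal).trans hF
  have hpos : 0 < v.asIdeal.ramificationIdx' w.asIdeal :=
    Nat.pos_of_ne_zero (Ideal.IsDedekindDomain.ramificationIdx'_ne_zero_of_liesOver w.asIdeal v.ne_bot)
  have he : v.asIdeal.ramificationIdx' w.asIdeal = 4 := by
    obtain ⟨c, hc⟩ := h4
    rcases c with _ | c
    · omega
    · nlinarith
  refine ⟨F, inferInstance, inferInstance, w, hw, ?_, Or.inl hgood⟩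
  rw [← Ideal.ramificationIdx'_eq_ramificationIdx v.asIdeal w.asIdeal v.ne_bot]
  exact he

/-- Hence **the semistability defect of a III / III* row at an odd prime is at most `4`**
(`semistabilityDefectAt_le`). [cite: FreitasKraus2022, §4 first paragraph] -/
theorem semistabilityDefectAt_le_four_of_kodairaSymbolAt_eq_III_or_IIIstar
    (hv : ((primesEquiv (R := ℤ) v : Nat.Primes) : ℕ) = p) (hp2 : p ≠ 2)
    (hK : W.kodairaSymbolAt v = .III ∨ W.kodairaSymbolAt v = .IIIstar) :
    W.semistabilityDefectAt p ≤ 4 :=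
  semistabilityDefectAt_le (W.isSemistabilityWitnessAt_four_of_kodairaSymbolAt_eq_III_or_IIIstar v hv hp2 hK)

/-- **The III / III* rows are potentially good**: `ord_p j(W) ≥ 0` (unconditionally, from the good
reduction over `ℚ(p^{1/4})` of §5 and Silverman VII.5.5; no hypothesis on `j` is needed below).
[cite: SilvermanAEC2009, VII.5 Prop. 5.5] -/
theorem padicValRat_j_nonneg_of_kodairaSymbolAt_eq_III_or_IIIstar
    (hv : ((primesEquiv (R := ℤ) v : Nat.Primes) : ℕ) = p) (hp2 : p ≠ 2)
    (hK : W.kodairaSymbolAt v = .III ∨ W.kodairaSymbolAt v = .IIIstar) :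
    0 ≤ padicValRat p W.j := by
  have hgen : natGenerator v = p := hv
  have hp : p.Prime := hgen ▸ prime_natGenerator v
  obtain ⟨F, _, _, θ, hθ, -⟩ := exists_numberField_pow_four_eq_natCast p
  obtain ⟨w, hw⟩ := exists_heightOneSpectrum_natCast_mem F hp
  haveI : w.asIdeal.LiesOver v.asIdeal := liesOver_of_natCast_mem' v hv w hw
  have hgood := W.hasGoodReductionAt_baseChange_of_pow_four_eq_of_kodairaSymbolAt_eq_III_or_IIIstar
    v hv hp2 hK hθ w hw
  have h := W.valuation_j_le_one_of_hasGoodReductionAt_baseChange_dedekind F (v := v) (w := w) hgood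
  by_cases hj0 : W.j = 0
  · rw [hj0]; simp
  rw [valuation_eq_exp_neg_padicValRat v hj0, hgen, ← exp_zero, exp_le_exp] at h
  omega

/-- **KRAUS / SERRE ON THE III / III* ROWS, PROVED: the semistability defect is EXACTLY `4`** at every
odd prime `p` (`W/ℚ` elliptic, Kodaira type III or III* at the place `v` of `ℤ` over `p`): `≤ 4` by the
witness `ℚ(p^{1/4})`, and `4 ∣ defect` by `SemistabilityDefectDiscriminantBoundProofs`
(`ord_p Δ_min ∈ {3, 9}`, `12 / gcd = 4`; `ord_p j ≥ 0` by the previous theorem). For `p ≥ 5` this is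
Serre 1972 §5.6 (`|Φ_p| = 12 / gcd(12, v(Δ))`) on these rows; for `p = 3` it is Kraus 1990 = Coppola
2020 Thm. 2.7, clauses III and III* (the named fact `kraus1990_semistabilityDefectAt_three`, second and
third conjuncts, now theorems). [cite: Coppola2020, §2 Thm. 2.7 (types III, III*: Gal_L ≅ C₄; held text arXiv:1812.05651 chunk p0006 L8–21)] [cite: FreitasKraus2022, §4 first paragraph (chunk p0032 L11–17)] [cite: Serre1972, §5.6 (p. 312), as quoted by MartinWatkins2006 §3.2] -/
theorem semistabilityDefectAt_eq_four_of_kodairaSymbolAt_eq_III_or_IIIstar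
    (hv : ((primesEquiv (R := ℤ) v : Nat.Primes) : ℕ) = p) (hp2 : p ≠ 2)
    (hK : W.kodairaSymbolAt v = .III ∨ W.kodairaSymbolAt v = .IIIstar) :
    W.semistabilityDefectAt p = 4 := by
  have hle := W.semistabilityDefectAt_le_four_of_kodairaSymbolAt_eq_III_or_IIIstar v hv hp2 hK
  have hpos : 0 < W.semistabilityDefectAt p := semistabilityDefectAt_pos_of_witness
    (W.isSemistabilityWitnessAt_four_of_kodairaSymbolAt_eq_III_or_IIIstar v hv hp2 hK)
  have hdvd := W.twelve_div_gcd_ordMinimalDiscriminant_dvd_semistabilityDefectAt v hv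
    (W.padicValRat_j_nonneg_of_kodairaSymbolAt_eq_III_or_IIIstar v hv hp2 hK)
  have h4 : 4 ∣ W.semistabilityDefectAt p := by
    rcases W.ordMinimalDiscriminant_eq_three_or_nine_of_kodairaSymbolAt_eq_III_or_IIIstar_of_ne_two
      v hv hp2 hK with h3 | h9
    · rw [h3] at hdvd; exact hdvd
    · rw [h9] at hdvd; exact hdvd
  obtain ⟨c, hc⟩ := h4
  rcases c with _ | c
  · omega
  · nlinarith

/-- **Every semistability witness on a III / III* row at an odd `p` has index a MULTIPLE OF `4`, and
`4` occurs** — the full content of "the minimal extension of `ℚ_p^{nr}` over which `E` acquires good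
reduction is the tame quartic one" in the witness language of `SemistabilityDefect.lean`.
[cite: FreitasKraus2022, §4 first paragraph] [cite: Coppola2020, §2 Thm. 2.7] -/
theorem four_dvd_of_isSemistabilityWitnessAt_of_kodairaSymbolAt_eq_III_or_IIIstar
    (hv : ((primesEquiv (R := ℤ) v : Nat.Primes) : ℕ) = p) (hp2 : p ≠ 2)
    (hK : W.kodairaSymbolAt v = .III ∨ W.kodairaSymbolAt v = .IIIstar) {e : ℕ}
    (he : W.IsSemistabilityWitnessAt p e) : 4 ∣ e := by
  have h := W.twelve_div_gcd_dvd_of_isSemistabilityWitnessAt v hv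
    (W.padicValRat_j_nonneg_of_kodairaSymbolAt_eq_III_or_IIIstar v hv hp2 hK) he
  rcases W.ordMinimalDiscriminant_eq_three_or_nine_of_kodairaSymbolAt_eq_III_or_IIIstar_of_ne_two
    v hv hp2 hK with h3 | h9
  · rw [h3] at h; exact h
  · rw [h9] at h; exact h

end Defect

/-! ## §7. At `p = 3`: the clauses III / III* of `kraus1990_semistabilityDefectAt_three` as theorems -/

section Three

open Rat.HeightOneSpectrum NumberField Literature.NumberTheory.EllipticCurves

variable (W : WeierstrassCurve ℚ) [W.IsElliptic] (v : HeightOneSpectrum ℤ)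

/-- **Kraus 1990 at `p = 3`, clause III, PROVED**: type III at `3` ⇒ semistability defect `4`
(hypothesis-free form of `semistabilityDefectAt_three_eq_four_of_kodairaSymbolAt_eq_III` of
`SemistabilityDefectAtThree.lean`). [cite: Coppola2020, §2 Thm. 2.7, second clause (Gal_L ≅ C₄)] [cite: Kraus1990, classification at p = 3, as restated by Coppola2020 Thm. 2.7] -/
theorem kraus_semistabilityDefectAt_three_eq_four_of_III
    (hv : ((primesEquiv (R := ℤ) v : Nat.Primes) : ℕ) = 3) (hK : W.kodairaSymbolAt v = .III) :
    W.semistabilityDefectAt 3 = 4 :=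
  W.semistabilityDefectAt_eq_four_of_kodairaSymbolAt_eq_III_or_IIIstar v hv (by decide) (Or.inl hK)

/-- **Kraus 1990 at `p = 3`, clause III*, PROVED**: type III* at `3` ⇒ semistability defect `4`.
[cite: Coppola2020, §2 Thm. 2.7, third clause (Gal_L ≅ C₄)] [cite: Kraus1990, classification at p = 3, as restated by Coppola2020 Thm. 2.7] -/
theorem kraus_semistabilityDefectAt_three_eq_four_of_IIIstar
    (hv : ((primesEquiv (R := ℤ) v : Nat.Primes) : ℕ) = 3) (hK : W.kodairaSymbolAt v = .IIIstar) :
    W.semistabilityDefectAt 3 = 4 :=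
  W.semistabilityDefectAt_eq_four_of_kodairaSymbolAt_eq_III_or_IIIstar v hv (by decide) (Or.inr hK)

/-- **The tame quartic witness at `3`** (route `TameQuarticManinParity`, "`n = 4 = e`"): on the
III / III* rows at `3` a number field and a place `w ∣ 3` with `e(w ∣ 3) = 4` at which `E` has good
reduction EXIST (hypothesis-free form of `isSemistabilityWitnessAt_three_four`).
[cite: FreitasKraus2022, §4 first paragraph] [cite: Coppola2020, §2 Thm. 2.7] -/
theorem isSemistabilityWitnessAt_three_four_of_kodairaSymbolAt_eq_III_or_IIIstar
    (hv : ((primesEquiv (R := ℤ) v : Nat.Primes) : ℕ) = 3)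
    (hK : W.kodairaSymbolAt v = .III ∨ W.kodairaSymbolAt v = .IIIstar) :
    W.IsSemistabilityWitnessAt 3 4 :=
  W.isSemistabilityWitnessAt_four_of_kodairaSymbolAt_eq_III_or_IIIstar v hv (by decide) hK

/-- **`e ∤ p − 1` and `e ∣ p + 1` at `p = 3` on the III / III* rows**, both conjuncts now PROVED
(hypothesis-free form of `not_semistabilityDefectAt_three_dvd_sub_one_of_kodairaSymbolAt_eq_III_or_IIIstar`;
the shape `if e ∣ q − 1 then q − 1 else q + 1` of `Summits/…/ManinAdditive/InertialTorusLaws.lean`).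
[cite: FreitasKraus2022, Thm. 15 (1) ("ℓ ≡ −1 (mod e)")] [cite: Coppola2020, §2 Thm. 2.7] -/
theorem not_dvd_two_and_dvd_four_semistabilityDefectAt_three_of_kodairaSymbolAt_eq_III_or_IIIstar
    (hv : ((primesEquiv (R := ℤ) v : Nat.Primes) : ℕ) = 3)
    (hK : W.kodairaSymbolAt v = .III ∨ W.kodairaSymbolAt v = .IIIstar) :
    ¬ W.semistabilityDefectAt 3 ∣ 3 - 1 ∧ W.semistabilityDefectAt 3 ∣ 3 + 1 := by
  rw [W.semistabilityDefectAt_eq_four_of_kodairaSymbolAt_eq_III_or_IIIstar v hv (by decide) hK]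
  decide

end Three

/-! ## §8. The tame QUADRATIC witness: on the `I₀*` row at an odd prime `p` the defect is EXACTLY `2`
(Kraus 1990 / Coppola 2020 Thm. 2.7, clause `I₀*`, at `p = 3`; Serre 1972 §5.6 at `p ≥ 5`) -/

section GeneralRescaling

open Rat.HeightOneSpectrum NumberField Literature.NumberTheory.EllipticCurves

variable (W : WeierstrassCurve ℚ) {p : ℕ} (v : HeightOneSpectrum ℤ)

/-- **The scaled model over a field containing `p^{1/n}`** (`n ≥ 1`; the general form of
`hasGoodReductionAt_baseChange_of_pow_four_eq_of_profile`): `C • W` a `ℚ`-rational equation with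
`v(aᵢ) ≥ kᵢ`, `v(Δ) = d`; `F` a number field with `θ ∈ F`, `θⁿ = p`; `w ∋ p`; `j` with `i·j ≤ n kᵢ`
(`i = 1, 2, 3, 4, 6`) and `n d = 12 j`. Then rescaling `(C • W)_F` by `u = θ^j` gives a `w`-integral
equation with unit discriminant, so `W_F` has good reduction at `w` (Silverman *AEC* VII.1 Remark 1.1,
VII.5.1 (a); `|θ|_w = |ϖ_w|^{e/n}`, `|x|_w = |x|_v^e`).
[cite: SilvermanAEC2009, VII.1 Remark 1.1 and VII.5 Prop. 5.1 (a)] [cite: FreitasKraus2022, Thm. 15 (1) ("we can take F = ℚ_ℓ(ℓ^{1/e})", e = 3, 4)] -/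
theorem hasGoodReductionAt_baseChange_of_pow_eq_of_profile
    (hv : ((primesEquiv (R := ℤ) v : Nat.Primes) : ℕ) = p) {C : VariableChange ℚ}
    {n k₁ k₂ k₃ k₄ k₆ d j : ℕ} (hn : 0 < n)
    (c₁ : v.valuation ℚ (C • W).a₁ ≤ exp (-(k₁ : ℤ))) (c₂ : v.valuation ℚ (C • W).a₂ ≤ exp (-(k₂ : ℤ)))
    (c₃ : v.valuation ℚ (C • W).a₃ ≤ exp (-(k₃ : ℤ))) (c₄ : v.valuation ℚ (C • W).a₄ ≤ exp (-(k₄ : ℤ)))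
    (c₆ : v.valuation ℚ (C • W).a₆ ≤ exp (-(k₆ : ℤ)))
    (cΔ : v.valuation ℚ (C • W).Δ = exp (-(d : ℤ)))
    (hk₁ : j ≤ n * k₁) (hk₂ : 2 * j ≤ n * k₂) (hk₃ : 3 * j ≤ n * k₃) (hk₄ : 4 * j ≤ n * k₄)
    (hk₆ : 6 * j ≤ n * k₆) (hd : n * d = 12 * j)
    {F : Type*} [Field F] [NumberField F] {θ : F} (hθ : θ ^ n = p)
    (w : HeightOneSpectrum (𝓞 F)) (hw : (p : 𝓞 F) ∈ w.asIdeal) :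
    (W.baseChange F).HasGoodReductionAt w := by
  haveI : w.asIdeal.LiesOver v.asIdeal := liesOver_of_natCast_mem' v hv w hw
  have hgen : natGenerator v = p := hv
  have hp : p.Prime := hgen ▸ prime_natGenerator v
  have hval : ∀ x : ℚ, w.valuation F (algebraMap ℚ F x) =
      v.valuation ℚ x ^ v.asIdeal.ramificationIdx' w.asIdeal := fun x =>
    (IsDedekindDomain.HeightOneSpectrum.valuation_liesOver F v w x).symm
  set e : ℕ := v.asIdeal.ramificationIdx' w.asIdeal with he
  have hvp : v.valuation ℚ (p : ℚ) = exp (-1 : ℤ) := by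
    rw [← hgen]; exact valuation_natGenerator_int v
  have hθ0 : θ ≠ 0 := by
    rintro rfl
    rw [zero_pow hn.ne'] at hθ
    exact hp.ne_zero (by exact_mod_cast hθ.symm)
  have hwθ0 : w.valuation F θ ≠ 0 := (Valuation.ne_zero_iff _).mpr hθ0
  set a : ℤ := log (w.valuation F θ) with ha
  have hθa : w.valuation F θ = exp a := (exp_log hwθ0).symm
  have hna : (n : ℤ) * a = -(e : ℤ) := by
    have h := congrArg (w.valuation F) hθ
    rw [map_pow, hθa, ← exp_nsmul, show ((p : ℕ) : F) = algebraMap ℚ F (p : ℚ) by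
      rw [map_natCast], hval, hvp, ← exp_nsmul, exp_inj] at h
    simpa using h
  set U : Fˣ := Units.mk0 (θ ^ j) (pow_ne_zero _ hθ0) with hU
  set X := (C • W).baseChange F with hX
  set Y := (⟨U, 0, 0, 0⟩ : VariableChange F) • X with hY
  obtain ⟨y₁, y₂, y₃, y₄, y₆, yΔ⟩ := variableChange_rescale_eq X U
  have hUval : ∀ i : ℕ, w.valuation F ((↑U⁻¹ : F) ^ i) = exp (-((i * j : ℕ) : ℤ) * a) := by
    intro i
    rw [Units.val_inv_eq_inv_val, hU, Units.val_mk0, map_pow, map_inv₀, map_pow, hθa,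
      ← exp_nsmul, ← exp_neg, ← exp_nsmul]
    congr 1
    push_cast
    ring
  have hXa : ∀ {x : ℚ} {k : ℕ}, v.valuation ℚ x ≤ exp (-(k : ℤ)) →
      w.valuation F (algebraMap ℚ F x) ≤ exp (-((k * e : ℕ) : ℤ)) := by
    intro x k hx
    rw [hval]
    calc v.valuation ℚ x ^ e ≤ exp (-(k : ℤ)) ^ e := pow_le_pow_left₀ zero_le hx e
      _ = exp (-((k * e : ℕ) : ℤ)) := by rw [← exp_nsmul]; congr 1; push_cast; ring
  have hcoef : ∀ {i k : ℕ} {x : ℚ}, i * j ≤ n * k → v.valuation ℚ x ≤ exp (-(k : ℤ)) →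
      w.valuation F ((↑U⁻¹ : F) ^ i * algebraMap ℚ F x) ≤ 1 := by
    intro i k x hik hx
    rw [map_mul, hUval]
    calc exp (-((i * j : ℕ) : ℤ) * a) * w.valuation F (algebraMap ℚ F x)
        ≤ exp (-((i * j : ℕ) : ℤ) * a) * exp (-((k * e : ℕ) : ℤ)) := mul_le_mul' le_rfl (hXa hx)
      _ = exp (-((i * j : ℕ) : ℤ) * a - ((k * e : ℕ) : ℤ)) := by rw [← exp_add]; rfl
      _ ≤ exp 0 := by
          rw [exp_le_exp]
          have : ((k * e : ℕ) : ℤ) = -(n * a) * k := by push_cast; rw [hna]; ring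
          rw [this]
          have hik' : ((i * j : ℕ) : ℤ) ≤ n * k := by exact_mod_cast hik
          have hn' : (0 : ℤ) < n := by exact_mod_cast hn
          have ha0 : a ≤ 0 := by
            have : (0 : ℤ) < e := by
              exact_mod_cast Nat.pos_of_ne_zero
                (Ideal.IsDedekindDomain.ramificationIdx'_ne_zero_of_liesOver w.asIdeal v.ne_bot)
            nlinarith
          nlinarith
      _ = 1 := exp_zero
  have hX₁ : X.a₁ = algebraMap ℚ F (C • W).a₁ := by rw [hX, baseChange, map_a₁]
  have hX₂ : X.a₂ = algebraMap ℚ F (C • W).a₂ := by rw [hX, baseChange, map_a₂]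
  have hX₃ : X.a₃ = algebraMap ℚ F (C • W).a₃ := by rw [hX, baseChange, map_a₃]
  have hX₄ : X.a₄ = algebraMap ℚ F (C • W).a₄ := by rw [hX, baseChange, map_a₄]
  have hX₆ : X.a₆ = algebraMap ℚ F (C • W).a₆ := by rw [hX, baseChange, map_a₆]
  have hXΔ : X.Δ = algebraMap ℚ F (C • W).Δ := by rw [hX, baseChange, map_Δ]
  have hint : Y.IsIntegralAt w := by
    rw [isIntegralAt_iff_valuation_le_one]
    refine ⟨?_, ?_, ?_, ?_, ?_⟩
    · rw [hY, y₁, ← pow_one (↑U⁻¹ : F), hX₁]; exact hcoef (by omega) c₁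
    · rw [hY, y₂, hX₂]; exact hcoef hk₂ c₂
    · rw [hY, y₃, hX₃]; exact hcoef hk₃ c₃
    · rw [hY, y₄, hX₄]; exact hcoef hk₄ c₄
    · rw [hY, y₆, hX₆]; exact hcoef hk₆ c₆
  have hΔ : w.valuation F Y.Δ = 1 := by
    rw [hY, yΔ, hXΔ, map_mul, hUval, hval, cΔ, ← exp_nsmul, ← exp_add, ← exp_zero, exp_inj,
      nsmul_eq_mul]
    have hd' : (n : ℤ) * d = 12 * j := by exact_mod_cast hd
    have he' : (e : ℤ) = -(n * a) := by rw [hna]; ring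
    push_cast
    rw [he']
    linear_combination a * hd'
  have hgoodY : Y.HasGoodReductionAt w := hasGoodReductionAt_of_valuation_Δ_eq_one_holds w Y hint hΔ
  have hgoodX : X.HasGoodReductionAt w := (hasGoodReductionAt_smul_iff_holds w X _).mp (hY ▸ hgoodY)
  rw [hX, baseChange_smul_eq] at hgoodX
  exact (hasGoodReductionAt_smul_iff_holds w (W.baseChange F) _).mp hgoodX

end GeneralRescaling

section QuadraticField

open Polynomial

/-- **A number field of degree `≤ n` containing an `n`-th root of `p`** (`n ≥ 1`):
`F = ℚ[X]/(minpoly of p^{1/n})`, `[F : ℚ] = deg(minpoly) ≤ n`. [folklore] -/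
private theorem exists_numberField_pow_eq_natCast (p : ℕ) {n : ℕ} (hn : 0 < n) :
    ∃ (F : Type) (_ : Field F) (_ : NumberField F) (θ : F), θ ^ n = p ∧ Module.finrank ℚ F ≤ n := by
  obtain ⟨θ₀, hθ₀⟩ := IsAlgClosed.exists_pow_nat_eq ((p : ℕ) : AlgebraicClosure ℚ) hn
  set g : ℚ[X] := X ^ n - C (p : ℚ) with hg
  have hg0 : g ≠ 0 := X_pow_sub_C_ne_zero hn _
  have hgθ : aeval θ₀ g = 0 := by simp [hg, hθ₀]
  have halg : IsAlgebraic ℚ θ₀ := ⟨g, hg0, hgθ⟩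
  have hint : _root_.IsIntegral ℚ θ₀ := halg.isIntegral
  haveI : Fact (Irreducible (minpoly ℚ θ₀)) := ⟨minpoly.irreducible hint⟩
  have hfg : minpoly ℚ θ₀ ∣ g := minpoly.dvd ℚ θ₀ hgθ
  have hf0 : minpoly ℚ θ₀ ≠ 0 := minpoly.ne_zero hint
  refine ⟨AdjoinRoot (minpoly ℚ θ₀), inferInstance, inferInstance, AdjoinRoot.root (minpoly ℚ θ₀),
    ?_, ?_⟩
  · obtain ⟨q, hq⟩ := hfg
    have h : g.eval₂ (AdjoinRoot.of (minpoly ℚ θ₀)) (AdjoinRoot.root (minpoly ℚ θ₀)) = 0 := by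
      rw [hq, eval₂_mul, AdjoinRoot.eval₂_root, zero_mul]
    rw [hg, eval₂_sub, eval₂_X_pow, eval₂_C, map_natCast, sub_eq_zero] at h
    exact h
  · have h1 := (AdjoinRoot.powerBasis hf0).finrank
    have h2 : (AdjoinRoot.powerBasis hf0).dim = (minpoly ℚ θ₀).natDegree := rfl
    have h3 : (minpoly ℚ θ₀).natDegree ≤ n :=
      (natDegree_le_of_dvd hfg hg0).trans (by rw [hg, natDegree_X_pow_sub_C])
    have key : Module.finrank ℚ (AdjoinRoot (minpoly ℚ θ₀)) ≤ n := by rw [h1, h2]; exact h3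
    convert key

end QuadraticField

section IstarZero

open Rat.HeightOneSpectrum NumberField Literature.NumberTheory.EllipticCurves
  Literature.NumberTheory.DiophantineGeometry

variable (W : WeierstrassCurve ℚ) [W.IsElliptic] {p : ℕ} (v : HeightOneSpectrum ℤ)

/-- **Type `I₀*`, rationally** (any Dedekind base is not needed here; `ℚ` at an odd `p`): some
`ℚ`-rational equation `C • W` has `v(a₁), v(a₂) ≥ 1`, `v(a₃), v(a₄) ≥ 2`, `v(a₆) ≥ 3` and `v(Δ) = 6`
(Silverman *ATAEC* IV.9.4 Step 6 and Table 4.1: `ord Δ = m + 1 = 6`; local normal form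
`LocalIndex.exists_smul_of_kodairaSymbolOfMinimal_eq_Istar_zero`, made rational by §3).
[cite: SilvermanATAEC1994, IV.9.4 Step 6 and Table 4.1 (type I₀*: v(Δ) = 6)] -/
theorem exists_variableChange_tateNormalForm_Istar_zero
    (hv : ((primesEquiv (R := ℤ) v : Nat.Primes) : ℕ) = p) (hp2 : p ≠ 2)
    (hK : W.kodairaSymbolAt v = .Istar 0) :
    ∃ C : VariableChange ℚ,
      v.valuation ℚ (C • W).a₁ ≤ exp (-1 : ℤ) ∧ v.valuation ℚ (C • W).a₂ ≤ exp (-1 : ℤ) ∧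
      v.valuation ℚ (C • W).a₃ ≤ exp (-2 : ℤ) ∧ v.valuation ℚ (C • W).a₄ ≤ exp (-2 : ℤ) ∧
      v.valuation ℚ (C • W).a₆ ≤ exp (-3 : ℤ) ∧ v.valuation ℚ (C • W).Δ = exp (-6 : ℤ) := by
  haveI : PerfectField (IsLocalRing.ResidueField (v.adicCompletionIntegers ℚ)) :=
    PerfectField.ofFinite
  have hgen : natGenerator v = p := hv
  have h2 : ringChar (ℤ ⧸ v.asIdeal) ≠ 2 := by rw [ringChar_int_quot_eq v, hgen]; exact hp2
  have hKV : (W.localMinimalIntegralModel v).kodairaSymbolOfMinimal = .Istar 0 := by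
    rw [← kodairaSymbolAt_def]; exact hK
  obtain ⟨D, h₁, h₂, h₃, h₄, h₆, -⟩ :=
    LocalIndex.exists_smul_of_kodairaSymbolOfMinimal_eq_Istar_zero _
      (localMinimalIntegralModel_Δ_ne_zero v W) hKV
  have hord : W.ordMinimalDiscriminant v = 6 := by
    have h := W.ordMinimalDiscriminant_eq_numComponentsAt_add_one_of_kodairaSymbolAt v h2
      (Or.inr (Or.inr ⟨0, hK⟩))
    unfold numComponentsAt at h
    rw [hK] at h
    exact h
  obtain ⟨C, c₁, c₂, c₃, c₄, c₆, cΔ⟩ := W.exists_variableChange_valuation_le_of_localModel v D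
    (k₁ := 1) (k₂ := 1) (k₃ := 2) (k₄ := 2) (k₆ := 3)
    (by rwa [pow_one]) (by rwa [pow_one]) h₃ h₄ h₆
  refine ⟨C, by simpa using c₁, by simpa using c₂, by simpa using c₃, by simpa using c₄,
    by simpa using c₆, ?_⟩
  rw [cΔ, hord]; rfl

/-- **Good reduction over any number field containing `√p`, on the `I₀*` row at an odd prime `p`**
(Tate's `I₀*` normal form rescaled by `√p`; Serre 1972 §5.6: `I₀*` at `p ≥ 5` is a ramified quadratic
twist of a good curve; at `p = 3` Kraus's `Gal_L ≅ C₂`). [cite: SilvermanATAEC1994, IV.9.4 Step 6 and Table 4.1] [cite: Coppola2020, §2 Thm. 2.7, first clause (type I₀*: Gal_L ≅ C₂)] -/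
theorem hasGoodReductionAt_baseChange_of_sq_eq_of_kodairaSymbolAt_eq_Istar_zero
    (hv : ((primesEquiv (R := ℤ) v : Nat.Primes) : ℕ) = p) (hp2 : p ≠ 2)
    (hK : W.kodairaSymbolAt v = .Istar 0)
    {F : Type*} [Field F] [NumberField F] {θ : F} (hθ : θ ^ 2 = p)
    (w : HeightOneSpectrum (𝓞 F)) (hw : (p : 𝓞 F) ∈ w.asIdeal) :
    (W.baseChange F).HasGoodReductionAt w := by
  obtain ⟨C, c₁, c₂, c₃, c₄, c₆, cΔ⟩ := W.exists_variableChange_tateNormalForm_Istar_zero v hv hp2 hK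
  exact W.hasGoodReductionAt_baseChange_of_pow_eq_of_profile v hv (n := 2)
    (k₁ := 1) (k₂ := 1) (k₃ := 2) (k₄ := 2) (k₆ := 3) (d := 6) (j := 1) (by norm_num)
    (by simpa using c₁) (by simpa using c₂) (by simpa using c₃) (by simpa using c₄)
    (by simpa using c₆) (by simpa using cΔ)
    (by norm_num) (by norm_num) (by norm_num) (by norm_num) (by norm_num) (by norm_num) hθ w hw

/-- `ord_p Δ_min = 6` on the `I₀*` row at an odd prime `p` (Silverman *ATAEC* IV Table 4.1).
[cite: SilvermanATAEC1994, IV.9 Table 4.1 (type I₀*)] -/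
theorem ordMinimalDiscriminant_eq_six_of_kodairaSymbolAt_eq_Istar_zero_of_ne_two
    (hv : ((primesEquiv (R := ℤ) v : Nat.Primes) : ℕ) = p) (hp2 : p ≠ 2)
    (hK : W.kodairaSymbolAt v = .Istar 0) : W.ordMinimalDiscriminant v = 6 := by
  haveI : PerfectField (IsLocalRing.ResidueField (v.adicCompletionIntegers ℚ)) :=
    PerfectField.ofFinite
  have hgen : natGenerator v = p := hv
  have h2 : ringChar (ℤ ⧸ v.asIdeal) ≠ 2 := by rw [ringChar_int_quot_eq v, hgen]; exact hp2
  have hn := W.ordMinimalDiscriminant_eq_numComponentsAt_add_one_of_kodairaSymbolAt v h2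
    (Or.inr (Or.inr ⟨0, hK⟩))
  unfold WeierstrassCurve.numComponentsAt at hn
  rw [hn, hK]; rfl

/-- **The witness of index `2` on the `I₀*` row** at an odd prime `p`: `F = ℚ(√p)` (`[F:ℚ] ≤ 2`), any
`w ∋ p`; `e(w ∣ p) = 2` because `2 = 12 / gcd(12, 6)` divides it and `e(w ∣ p) ≤ [F : ℚ] ≤ 2`.
[cite: Coppola2020, §2 Thm. 2.7, first clause (Gal_L ≅ C₂)] [cite: SilvermanAEC2009, VII.5 Prop. 5.5 (proof) and VII.1 Prop. 1.3] -/
theorem isSemistabilityWitnessAt_two_of_kodairaSymbolAt_eq_Istar_zero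
    (hv : ((primesEquiv (R := ℤ) v : Nat.Primes) : ℕ) = p) (hp2 : p ≠ 2)
    (hK : W.kodairaSymbolAt v = .Istar 0) : W.IsSemistabilityWitnessAt p 2 := by
  have hgen : natGenerator v = p := hv
  have hp : p.Prime := hgen ▸ prime_natGenerator v
  obtain ⟨F, _, _, θ, hθ, hF⟩ := exists_numberField_pow_eq_natCast p (n := 2) (by norm_num)
  obtain ⟨w, hw⟩ := exists_heightOneSpectrum_natCast_mem F hp
  have hgood := W.hasGoodReductionAt_baseChange_of_sq_eq_of_kodairaSymbolAt_eq_Istar_zero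
    v hv hp2 hK hθ w hw
  haveI : w.asIdeal.LiesOver v.asIdeal := liesOver_of_natCast_mem' v hv w hw
  haveI := w.isPrime
  haveI := v.isMaximal
  have h12 := W.twelve_dvd_ramificationIdx_mul_ordMinimalDiscriminant_of_hasGoodReductionAt_baseChange
    F (v := v) (w := w) hgood
  rw [W.ordMinimalDiscriminant_eq_six_of_kodairaSymbolAt_eq_Istar_zero_of_ne_two v hv hp2 hK] at h12
  have hle : v.asIdeal.ramificationIdx' w.asIdeal ≤ 2 :=
    (Ideal.ramificationIdx_le_finrank (𝓞 F) ℚ F w.asIdeal).trans hF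
  have hpos : 0 < v.asIdeal.ramificationIdx' w.asIdeal :=
    Nat.pos_of_ne_zero (Ideal.IsDedekindDomain.ramificationIdx'_ne_zero_of_liesOver w.asIdeal v.ne_bot)
  have he : v.asIdeal.ramificationIdx' w.asIdeal = 2 := by omega
  refine ⟨F, inferInstance, inferInstance, w, hw, ?_, Or.inl hgood⟩
  rw [← Ideal.ramificationIdx'_eq_ramificationIdx v.asIdeal w.asIdeal v.ne_bot]
  exact he

/-- The `I₀*` row at an odd `p` is potentially good: `ord_p j ≥ 0` (from the good reduction over
`ℚ(√p)`; Silverman VII.5.5). [cite: SilvermanAEC2009, VII.5 Prop. 5.5] -/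
theorem padicValRat_j_nonneg_of_kodairaSymbolAt_eq_Istar_zero
    (hv : ((primesEquiv (R := ℤ) v : Nat.Primes) : ℕ) = p) (hp2 : p ≠ 2)
    (hK : W.kodairaSymbolAt v = .Istar 0) : 0 ≤ padicValRat p W.j := by
  have hgen : natGenerator v = p := hv
  have hp : p.Prime := hgen ▸ prime_natGenerator v
  obtain ⟨F, _, _, θ, hθ, -⟩ := exists_numberField_pow_eq_natCast p (n := 2) (by norm_num)
  obtain ⟨w, hw⟩ := exists_heightOneSpectrum_natCast_mem F hp
  haveI : w.asIdeal.LiesOver v.asIdeal := liesOver_of_natCast_mem' v hv w hw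
  have hgood := W.hasGoodReductionAt_baseChange_of_sq_eq_of_kodairaSymbolAt_eq_Istar_zero
    v hv hp2 hK hθ w hw
  have h := W.valuation_j_le_one_of_hasGoodReductionAt_baseChange_dedekind F (v := v) (w := w) hgood
  by_cases hj0 : W.j = 0
  · rw [hj0]; simp
  rw [valuation_eq_exp_neg_padicValRat v hj0, hgen, ← exp_zero, exp_le_exp] at h
  omega

/-- **KRAUS / SERRE ON THE `I₀*` ROW, PROVED: the semistability defect is EXACTLY `2`** at every odd
prime `p` (`≤ 2` by `ℚ(√p)`, `2 ∣ defect` by `12 / gcd(12, 6) = 2`). At `p = 3` this is clause 1 of the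
named fact `kraus1990_semistabilityDefectAt_three` ("if `E` has type `I₀*`, then … `Gal_L ≅ C₂`"), now
a theorem; at `p ≥ 5` it is Serre 1972 §5.6 on this row.
[cite: Coppola2020, §2 Thm. 2.7, first clause (type I₀*: Gal_L ≅ C₂; held text arXiv:1812.05651 chunk p0006 L8–21)] [cite: Serre1972, §5.6 (p. 312), as quoted by MartinWatkins2006 §3.2] -/
theorem semistabilityDefectAt_eq_two_of_kodairaSymbolAt_eq_Istar_zero
    (hv : ((primesEquiv (R := ℤ) v : Nat.Primes) : ℕ) = p) (hp2 : p ≠ 2)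
    (hK : W.kodairaSymbolAt v = .Istar 0) : W.semistabilityDefectAt p = 2 := by
  have hwit := W.isSemistabilityWitnessAt_two_of_kodairaSymbolAt_eq_Istar_zero v hv hp2 hK
  have hle := semistabilityDefectAt_le hwit
  have hpos : 0 < W.semistabilityDefectAt p := semistabilityDefectAt_pos_of_witness hwit
  have hdvd := W.twelve_div_gcd_ordMinimalDiscriminant_dvd_semistabilityDefectAt v hv
    (W.padicValRat_j_nonneg_of_kodairaSymbolAt_eq_Istar_zero v hv hp2 hK)
  rw [W.ordMinimalDiscriminant_eq_six_of_kodairaSymbolAt_eq_Istar_zero_of_ne_two v hv hp2 hK] at hdvd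
  have h2 : 2 ∣ W.semistabilityDefectAt p := hdvd
  omega

/-- **Kraus 1990 at `p = 3`, clause `I₀*`, PROVED**: type `I₀*` at `3` ⇒ semistability defect `2`
(hypothesis-free form of `semistabilityDefectAt_three_eq_two_of_kodairaSymbolAt_eq_Istar_zero` of
`SemistabilityDefectAtThree.lean`; the census cell (G) at `3`, where `e ∣ q − 1`).
[cite: Coppola2020, §2 Thm. 2.7, first clause (Gal_L ≅ C₂)] [cite: Kraus1990, classification at p = 3, as restated by Coppola2020 Thm. 2.7] -/
theorem kraus_semistabilityDefectAt_three_eq_two_of_Istar_zero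
    (hv : ((primesEquiv (R := ℤ) v : Nat.Primes) : ℕ) = 3) (hK : W.kodairaSymbolAt v = .Istar 0) :
    W.semistabilityDefectAt 3 = 2 :=
  W.semistabilityDefectAt_eq_two_of_kodairaSymbolAt_eq_Istar_zero v hv (by decide) hK

/-- On the `I₀*` row at `3` the defect DIVIDES `3 − 1` (the principal-series shape `e ∣ q − 1` of
`Summits/…/ManinAdditive/InertialTorusLaws.lean`), unconditionally. [cite: Coppola2020, §2 Thm. 2.7, first clause] -/
theorem semistabilityDefectAt_three_dvd_two_of_kodairaSymbolAt_eq_Istar_zero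
    (hv : ((primesEquiv (R := ℤ) v : Nat.Primes) : ℕ) = 3) (hK : W.kodairaSymbolAt v = .Istar 0) :
    W.semistabilityDefectAt 3 ∣ 3 - 1 := by
  rw [W.kraus_semistabilityDefectAt_three_eq_two_of_Istar_zero v hv hK]

end IstarZero

end WeierstrassCurve

end
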